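import Mathlib.Tactic.Ring
import Mathlib.Tactic.Linarith
import Mathlib.Tactic.Positivity
import Mathlib.Tactic.LinearCombination
import Mathlib.Data.Real.Basic
import Summits.HodgeConjecture.HodgeConjecture.Theorems.WeilClassTestFormatFiveThreeLineQuintic
import Summits.HodgeConjecture.HodgeConjecture.Theorems.WeilClassTestFormatFiveThreePattern044
import HarnessLib

/-!
# Conjecture N (hodge-weil ladder, GAPS G51b), format (5,3): TYPE REDUCTIONS FOR THE OPEN MIXED PATTERNS (where the virtual roots `±ρ` sit)

Prover 2, generation 18 (note `run/shared/lean/b2b/hodge-weil/b2b-hweil-pv2-g18/MOMENTS-G18.md`, ADDENDUM 1). In the moment picture the E-charges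
`u` and `(v₁,v₂,v₃,ρ,−ρ)` (`ρ ≥ 0`, `ρ² = S/2`) share `p₁,p₂,p₃`; a TYPE is the interleaving of the ten points. For `Q₄ < 0` (negative slope of the
line `ℓ`, pv2-g17 `Q4_eq_slope`) the signs `ℓ(v_g) = K₀(g)` and the wall values `w(u_e)·∏_g(u_e − v_g) = ℓ(u_e)` (`w(x) = x² − S/2 = (x−ρ)(x+ρ)`)
confine `±ρ`: THIS FILE proves, charge data only (centring + P4 + the sorted pattern + `Q₄ < 0`),
* (0,2,3) `v₁ < u₁ ≤ u₂ < v₂ < u₃ < v₃ < u₄ ≤ u₅`: `u₂ < −ρ`, `−ρ < u₄`, `u₅ < ρ` (`types_023`) — 4 types remain (`−ρ` against `v₂, u₃, v₃`);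
* (0,2,4) `v₁ < u₁ ≤ u₂ < v₂ < u₃ ≤ u₄ < v₃ < u₅`: `u₂ < −ρ`, `−ρ < u₃`, `u₄ < ρ` (`types_024`) — 6 types remain;
* (1,1,3) `u₁ < v₁ ≤ v₂ < u₂ ≤ u₃ < v₃ < u₄ ≤ u₅`: `u₃ < −ρ`, `−ρ < u₄`, `u₅ < ρ` (`types_113`) — 2 types remain;
* (1,3,3) `u₁ < v₁ < u₂ ≤ u₃ < v₂ ≤ v₃ < u₄ ≤ u₅`: `−ρ < u₂`, `u₅ < ρ` (`types_133_core`), and with positions (P2 + ampleness, wall lemma) also `u₁ < −ρ` (`types_133`);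
* (0,3,3) `v₁ < u₁ ≤ u₂ ≤ u₃ < v₂ ≤ v₃ < u₄ ≤ u₅`: `−ρ < u₄`, `u₅ < ρ` (`types_033_core`), and with positions `v₁ < −ρ` (`types_033`).
In every case `S > 0` is a consequence (some wall is negative). Mirrors ((2,3,5), (1,3,5), (2,4,4), (2,2,4), (2,2,5)) by `u ↦ −u`.
These are the case lists on which per-type certificates (`code/pv2-g18/certjobT/`) operate. Pure algebra; nothing here is a case of HC, a rung
or a door edge; no statement of Markman's papers is used. New cell result ⇒ Summits/.
-/

set_option linter.dupNamespace false

open Summit.HodgeConjecture.HodgeConjecture.WeilClassTestFormatFiveThreeLineQuintic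
open Summit.HodgeConjecture.HodgeConjecture.WeilClassTestFormatFiveThreePattern044

namespace Summit.HodgeConjecture.HodgeConjecture.WeilClassTestFormatFiveThreeTypes

/-- wall helper: a negative wall `x² − S/2 < 0` with `ρ ≥ 0`, `ρ² = S/2` puts `x` strictly inside `(−ρ, ρ)`. -/
theorem inside_of_wall_neg (x ρ s : ℝ) (hρ : 0 ≤ ρ) (hρ2 : ρ ^ 2 = s / 2) (hw : x ^ 2 - s / 2 < 0) : -ρ < x ∧ x < ρ := by
  have e : x ^ 2 - s / 2 = (x - ρ) * (x + ρ) := by linear_combination hρ2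
  rw [e] at hw
  constructor
  · by_contra h
    have h' : x + ρ ≤ 0 := by linarith [not_lt.mp h]
    have : 0 ≤ (x - ρ) * (x + ρ) := mul_nonneg_of_nonpos_of_nonpos (by linarith) h'
    linarith
  · by_contra h
    have h' : 0 ≤ x - ρ := by linarith [not_lt.mp h]
    have : 0 ≤ (x - ρ) * (x + ρ) := mul_nonneg h' (by linarith)
    linarith

/-- sign helper: `a·b < 0` with `b < 0` gives `0 < a`. -/
theorem pos_of_mul_neg_of_neg (a b : ℝ) (h : a * b < 0) (hb : b < 0) : 0 < a := by nlinarith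

/-- wall helper: a positive wall with `x < ρ`... precisely `x ≤ y`, `y < ρ` and `x² − S/2 > 0` give `x < −ρ`. -/
theorem lt_neg_of_wall_pos_of_lt (x y ρ s : ℝ) (hρ2 : ρ ^ 2 = s / 2) (hw : 0 < x ^ 2 - s / 2) (hxy : x ≤ y) (hy : y < ρ) : x < -ρ :=
  lt_neg_of_wall_pos x ρ s hρ2 hw (by linarith)

set_option maxHeartbeats 1600000 in
/-- TYPE REDUCTION for (0,2,3) (`v₁ < u₁ ≤ u₂ < v₂ < u₃ < v₃ < u₄ ≤ u₅`, `Q₄ < 0`, `ρ ≥ 0`, `ρ² = S/2`): `u₂ < −ρ`, `−ρ < u₄` and `u₅ < ρ` (so `−ρ` lies in one of the four slots between `u₂` and `u₄`, and every charge is `< ρ`). Charge data only (centring + P4). -/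
theorem types_023 (u₁ u₂ u₃ u₄ u₅ v₁ v₂ v₃ ρ : ℝ)
    (hC : u₁ + u₂ + u₃ + u₄ + u₅ = v₁ + v₂ + v₃)
    (hP4 : (u₁ ^ 3 + u₂ ^ 3 + u₃ ^ 3 + u₄ ^ 3 + u₅ ^ 3) - (v₁ ^ 3 + v₂ ^ 3 + v₃ ^ 3) = 0)
    (h₁ : v₁ < u₁) (h₁₂ : u₁ ≤ u₂) (h₂ : u₂ < v₂) (h₃ : v₂ < u₃) (h₃' : u₃ < v₃) (h₄ : v₃ < u₄) (h₄₅ : u₄ ≤ u₅)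
    (hQ4 : 3 * ((u₁ ^ 4 + u₂ ^ 4 + u₃ ^ 4 + u₄ ^ 4 + u₅ ^ 4) - (v₁ ^ 4 + v₂ ^ 4 + v₃ ^ 4)) - (3 / 2) * ((u₁ ^ 2 + u₂ ^ 2 + u₃ ^ 2 + u₄ ^ 2 + u₅ ^ 2) - (v₁ ^ 2 + v₂ ^ 2 + v₃ ^ 2)) ^ 2 < 0)
    (hρ : 0 ≤ ρ) (hρ2 : ρ ^ 2 = ((u₁ ^ 2 + u₂ ^ 2 + u₃ ^ 2 + u₄ ^ 2 + u₅ ^ 2) - (v₁ ^ 2 + v₂ ^ 2 + v₃ ^ 2)) / 2) :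
    u₂ < -ρ ∧ -ρ < u₄ ∧ u₅ < ρ := by
  have hσ : (-((u₁ * u₂ * u₃ * u₄ + u₁ * u₂ * u₃ * u₅ + u₁ * u₂ * u₄ * u₅ + u₁ * u₃ * u₄ * u₅ + u₂ * u₃ * u₄ * u₅) + (v₁ * v₂ + v₁ * v₃ + v₂ * v₃) * ((u₁ ^ 2 + u₂ ^ 2 + u₃ ^ 2 + u₄ ^ 2 + u₅ ^ 2) - (v₁ ^ 2 + v₂ ^ 2 + v₃ ^ 2)) / 2)) < 0 := by
    have e := Q4_eq_slope u₁ u₂ u₃ u₄ u₅ v₁ v₂ v₃ hC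
    rw [hP4] at e
    linarith only [e, hQ4]
  have k21 : u₁ - v₂ < 0 := by linarith only [h₁, h₁₂, h₂, h₃, h₃', h₄, h₄₅]
  have k22 : u₂ - v₂ < 0 := by linarith only [h₁, h₁₂, h₂, h₃, h₃', h₄, h₄₅]
  have k23 : 0 < u₃ - v₂ := by linarith only [h₁, h₁₂, h₂, h₃, h₃', h₄, h₄₅]
  have k24 : 0 < u₄ - v₂ := by linarith only [h₁, h₁₂, h₂, h₃, h₃', h₄, h₄₅]
  have k25 : 0 < u₅ - v₂ := by linarith only [h₁, h₁₂, h₂, h₃, h₃', h₄, h₄₅]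
  have hK2 : 0 < (u₁ - v₂) * (u₂ - v₂) * (u₃ - v₂) * (u₄ - v₂) * (u₅ - v₂) := (mul_pos (mul_pos (mul_pos (mul_pos_of_neg_of_neg k21 k22) k23) k24) k25)

  have hl2 := K0_eq_line₂ u₁ u₂ u₃ u₄ u₅ v₁ v₂ v₃ hC hP4
  have k31 : u₁ - v₃ < 0 := by linarith only [h₁, h₁₂, h₂, h₃, h₃', h₄, h₄₅]
  have k32 : u₂ - v₃ < 0 := by linarith only [h₁, h₁₂, h₂, h₃, h₃', h₄, h₄₅]
  have k33 : u₃ - v₃ < 0 := by linarith only [h₁, h₁₂, h₂, h₃, h₃', h₄, h₄₅]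
  have k34 : 0 < u₄ - v₃ := by linarith only [h₁, h₁₂, h₂, h₃, h₃', h₄, h₄₅]
  have k35 : 0 < u₅ - v₃ := by linarith only [h₁, h₁₂, h₂, h₃, h₃', h₄, h₄₅]
  have hK3 : (u₁ - v₃) * (u₂ - v₃) * (u₃ - v₃) * (u₄ - v₃) * (u₅ - v₃) < 0 := (mul_neg_of_neg_of_pos (mul_neg_of_neg_of_pos (mul_neg_of_pos_of_neg (mul_pos_of_neg_of_neg k31 k32) k33) k34) k35)

  have hl3 := K0_eq_line₃ u₁ u₂ u₃ u₄ u₅ v₁ v₂ v₃ hC hP4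
  have eu2 : (((u₁ * u₂ * u₃ * u₄ * u₅) + (v₁ * v₂ * v₃) * ((u₁ ^ 2 + u₂ ^ 2 + u₃ ^ 2 + u₄ ^ 2 + u₅ ^ 2) - (v₁ ^ 2 + v₂ ^ 2 + v₃ ^ 2)) / 2) + (-((u₁ * u₂ * u₃ * u₄ + u₁ * u₂ * u₃ * u₅ + u₁ * u₂ * u₄ * u₅ + u₁ * u₃ * u₄ * u₅ + u₂ * u₃ * u₄ * u₅) + (v₁ * v₂ + v₁ * v₃ + v₂ * v₃) * ((u₁ ^ 2 + u₂ ^ 2 + u₃ ^ 2 + u₄ ^ 2 + u₅ ^ 2) - (v₁ ^ 2 + v₂ ^ 2 + v₃ ^ 2)) / 2)) * u₂) = (((u₁ * u₂ * u₃ * u₄ * u₅) + (v₁ * v₂ * v₃) * ((u₁ ^ 2 + u₂ ^ 2 + u₃ ^ 2 + u₄ ^ 2 + u₅ ^ 2) - (v₁ ^ 2 + v₂ ^ 2 + v₃ ^ 2)) / 2) + (-((u₁ * u₂ * u₃ * u₄ + u₁ * u₂ * u₃ * u₅ + u₁ * u₂ * u₄ * u₅ + u₁ * u₃ * u₄ *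 u₅ + u₂ * u₃ * u₄ * u₅) + (v₁ * v₂ + v₁ * v₃ + v₂ * v₃) * ((u₁ ^ 2 + u₂ ^ 2 + u₃ ^ 2 + u₄ ^ 2 + u₅ ^ 2) - (v₁ ^ 2 + v₂ ^ 2 + v₃ ^ 2)) / 2)) * v₂) + (-((u₁ * u₂ * u₃ * u₄ + u₁ * u₂ * u₃ * u₅ + u₁ * u₂ * u₄ * u₅ + u₁ * u₃ * u₄ * u₅ + u₂ * u₃ * u₄ * u₅) + (v₁ * v₂ + v₁ * v₃ + v₂ * v₃) * ((u₁ ^ 2 + u₂ ^ 2 + u₃ ^ 2 + u₄ ^ 2 + u₅ ^ 2) - (v₁ ^ 2 + v₂ ^ 2 + v₃ ^ 2)) / 2)) * (u₂ - v₂) := by ring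
  have hlu2 : 0 < (((u₁ * u₂ * u₃ * u₄ * u₅) + (v₁ * v₂ * v₃) * ((u₁ ^ 2 + u₂ ^ 2 + u₃ ^ 2 + u₄ ^ 2 + u₅ ^ 2) - (v₁ ^ 2 + v₂ ^ 2 + v₃ ^ 2)) / 2) + (-((u₁ * u₂ * u₃ * u₄ + u₁ * u₂ * u₃ * u₅ + u₁ * u₂ * u₄ * u₅ + u₁ * u₃ * u₄ * u₅ + u₂ * u₃ * u₄ * u₅) + (v₁ * v₂ + v₁ * v₃ + v₂ * v₃) * ((u₁ ^ 2 + u₂ ^ 2 + u₃ ^ 2 + u₄ ^ 2 + u₅ ^ 2) - (v₁ ^ 2 + v₂ ^ 2 + v₃ ^ 2)) / 2)) * u₂) := by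
    rw [eu2, ← hl2]
    have : 0 < (-((u₁ * u₂ * u₃ * u₄ + u₁ * u₂ * u₃ * u₅ + u₁ * u₂ * u₄ * u₅ + u₁ * u₃ * u₄ * u₅ + u₂ * u₃ * u₄ * u₅) + (v₁ * v₂ + v₁ * v₃ + v₂ * v₃) * ((u₁ ^ 2 + u₂ ^ 2 + u₃ ^ 2 + u₄ ^ 2 + u₅ ^ 2) - (v₁ ^ 2 + v₂ ^ 2 + v₃ ^ 2)) / 2)) * (u₂ - v₂) := mul_pos_of_neg_of_neg hσ (by linarith only [h₁, h₁₂, h₂, h₃, h₃', h₄, h₄₅])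
    linarith only [hK2, this]
  have eu4 : (((u₁ * u₂ * u₃ * u₄ * u₅) + (v₁ * v₂ * v₃) * ((u₁ ^ 2 + u₂ ^ 2 + u₃ ^ 2 + u₄ ^ 2 + u₅ ^ 2) - (v₁ ^ 2 + v₂ ^ 2 + v₃ ^ 2)) / 2) + (-((u₁ * u₂ * u₃ * u₄ + u₁ * u₂ * u₃ * u₅ + u₁ * u₂ * u₄ * u₅ + u₁ * u₃ * u₄ * u₅ + u₂ * u₃ * u₄ * u₅) + (v₁ * v₂ + v₁ * v₃ + v₂ * v₃) * ((u₁ ^ 2 + u₂ ^ 2 + u₃ ^ 2 + u₄ ^ 2 + u₅ ^ 2) - (v₁ ^ 2 + v₂ ^ 2 + v₃ ^ 2)) / 2)) * u₄) = (((u₁ * u₂ * u₃ * u₄ * u₅) + (v₁ * v₂ * v₃) * ((u₁ ^ 2 + u₂ ^ 2 + u₃ ^ 2 + u₄ ^ 2 + u₅ ^ 2) - (v₁ ^ 2 + v₂ ^ 2 + v₃ ^ 2)) / 2) + (-((u₁ * u₂ * u₃ * u₄ + u₁ * u₂ * u₃ * u₅ + u₁ * u₂ * u₄ * u₅ + u₁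 * u₃ * u₄ * u₅ + u₂ * u₃ * u₄ * u₅) + (v₁ * v₂ + v₁ * v₃ + v₂ * v₃) * ((u₁ ^ 2 + u₂ ^ 2 + u₃ ^ 2 + u₄ ^ 2 + u₅ ^ 2) - (v₁ ^ 2 + v₂ ^ 2 + v₃ ^ 2)) / 2)) * v₃) + (-((u₁ * u₂ * u₃ * u₄ + u₁ * u₂ * u₃ * u₅ + u₁ * u₂ * u₄ * u₅ + u₁ * u₃ * u₄ * u₅ + u₂ * u₃ * u₄ * u₅) + (v₁ * v₂ + v₁ * v₃ + v₂ * v₃) * ((u₁ ^ 2 + u₂ ^ 2 + u₃ ^ 2 + u₄ ^ 2 + u₅ ^ 2) - (v₁ ^ 2 + v₂ ^ 2 + v₃ ^ 2)) / 2)) * (u₄ - v₃) := by ring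
  have hlu4 : (((u₁ * u₂ * u₃ * u₄ * u₅) + (v₁ * v₂ * v₃) * ((u₁ ^ 2 + u₂ ^ 2 + u₃ ^ 2 + u₄ ^ 2 + u₅ ^ 2) - (v₁ ^ 2 + v₂ ^ 2 + v₃ ^ 2)) / 2) + (-((u₁ * u₂ * u₃ * u₄ + u₁ * u₂ * u₃ * u₅ + u₁ * u₂ * u₄ * u₅ + u₁ * u₃ * u₄ * u₅ + u₂ * u₃ * u₄ * u₅) + (v₁ * v₂ + v₁ * v₃ + v₂ * v₃) * ((u₁ ^ 2 + u₂ ^ 2 + u₃ ^ 2 + u₄ ^ 2 + u₅ ^ 2) - (v₁ ^ 2 + v₂ ^ 2 + v₃ ^ 2)) / 2)) * u₄) < 0 := by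
    rw [eu4, ← hl3]
    have : (-((u₁ * u₂ * u₃ * u₄ + u₁ * u₂ * u₃ * u₅ + u₁ * u₂ * u₄ * u₅ + u₁ * u₃ * u₄ * u₅ + u₂ * u₃ * u₄ * u₅) + (v₁ * v₂ + v₁ * v₃ + v₂ * v₃) * ((u₁ ^ 2 + u₂ ^ 2 + u₃ ^ 2 + u₄ ^ 2 + u₅ ^ 2) - (v₁ ^ 2 + v₂ ^ 2 + v₃ ^ 2)) / 2)) * (u₄ - v₃) < 0 := mul_neg_of_neg_of_pos hσ (by linarith only [h₁, h₁₂, h₂, h₃, h₃', h₄, h₄₅])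
    linarith only [hK3, this]
  have eu5 : (((u₁ * u₂ * u₃ * u₄ * u₅) + (v₁ * v₂ * v₃) * ((u₁ ^ 2 + u₂ ^ 2 + u₃ ^ 2 + u₄ ^ 2 + u₅ ^ 2) - (v₁ ^ 2 + v₂ ^ 2 + v₃ ^ 2)) / 2) + (-((u₁ * u₂ * u₃ * u₄ + u₁ * u₂ * u₃ * u₅ + u₁ * u₂ * u₄ * u₅ + u₁ * u₃ * u₄ * u₅ + u₂ * u₃ * u₄ * u₅) + (v₁ * v₂ + v₁ * v₃ + v₂ * v₃) * ((u₁ ^ 2 + u₂ ^ 2 + u₃ ^ 2 + u₄ ^ 2 + u₅ ^ 2) - (v₁ ^ 2 + v₂ ^ 2 + v₃ ^ 2)) / 2)) * u₅) = (((u₁ * u₂ * u₃ * u₄ * u₅) + (v₁ * v₂ * v₃) * ((u₁ ^ 2 + u₂ ^ 2 + u₃ ^ 2 + u₄ ^ 2 + u₅ ^ 2) - (v₁ ^ 2 + v₂ ^ 2 + v₃ ^ 2)) / 2) + (-((u₁ * u₂ * u₃ * u₄ + u₁ * u₂ * u₃ * u₅ + u₁ * u₂ * u₄ * u₅ + u₁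 * u₃ * u₄ * u₅ + u₂ * u₃ * u₄ * u₅) + (v₁ * v₂ + v₁ * v₃ + v₂ * v₃) * ((u₁ ^ 2 + u₂ ^ 2 + u₃ ^ 2 + u₄ ^ 2 + u₅ ^ 2) - (v₁ ^ 2 + v₂ ^ 2 + v₃ ^ 2)) / 2)) * v₃) + (-((u₁ * u₂ * u₃ * u₄ + u₁ * u₂ * u₃ * u₅ + u₁ * u₂ * u₄ * u₅ + u₁ * u₃ * u₄ * u₅ + u₂ * u₃ * u₄ * u₅) + (v₁ * v₂ + v₁ * v₃ + v₂ * v₃) * ((u₁ ^ 2 + u₂ ^ 2 + u₃ ^ 2 + u₄ ^ 2 + u₅ ^ 2) - (v₁ ^ 2 + v₂ ^ 2 + v₃ ^ 2)) / 2)) * (u₅ - v₃) := by ring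
  have hlu5 : (((u₁ * u₂ * u₃ * u₄ * u₅) + (v₁ * v₂ * v₃) * ((u₁ ^ 2 + u₂ ^ 2 + u₃ ^ 2 + u₄ ^ 2 + u₅ ^ 2) - (v₁ ^ 2 + v₂ ^ 2 + v₃ ^ 2)) / 2) + (-((u₁ * u₂ * u₃ * u₄ + u₁ * u₂ * u₃ * u₅ + u₁ * u₂ * u₄ * u₅ + u₁ * u₃ * u₄ * u₅ + u₂ * u₃ * u₄ * u₅) + (v₁ * v₂ + v₁ * v₃ + v₂ * v₃) * ((u₁ ^ 2 + u₂ ^ 2 + u₃ ^ 2 + u₄ ^ 2 + u₅ ^ 2) - (v₁ ^ 2 + v₂ ^ 2 + v₃ ^ 2)) / 2)) * u₅) < 0 := by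
    rw [eu5, ← hl3]
    have : (-((u₁ * u₂ * u₃ * u₄ + u₁ * u₂ * u₃ * u₅ + u₁ * u₂ * u₄ * u₅ + u₁ * u₃ * u₄ * u₅ + u₂ * u₃ * u₄ * u₅) + (v₁ * v₂ + v₁ * v₃ + v₂ * v₃) * ((u₁ ^ 2 + u₂ ^ 2 + u₃ ^ 2 + u₄ ^ 2 + u₅ ^ 2) - (v₁ ^ 2 + v₂ ^ 2 + v₃ ^ 2)) / 2)) * (u₅ - v₃) < 0 := mul_neg_of_neg_of_pos hσ (by linarith only [h₁, h₁₂, h₂, h₃, h₃', h₄, h₄₅])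
    linarith only [hK3, this]
  have c21 : 0 < u₂ - v₁ := by linarith only [h₁, h₁₂, h₂, h₃, h₃', h₄, h₄₅]
  have c22 : u₂ - v₂ < 0 := by linarith only [h₁, h₁₂, h₂, h₃, h₃', h₄, h₄₅]
  have c23 : u₂ - v₃ < 0 := by linarith only [h₁, h₁₂, h₂, h₃, h₃', h₄, h₄₅]
  have hC2 : 0 < ((u₂ - v₁) * (u₂ - v₂) * (u₂ - v₃)) := (mul_pos_of_neg_of_neg (mul_neg_of_pos_of_neg c21 c22) c23)
  have hq2 := wall_eq_line₂ u₁ u₂ u₃ u₄ u₅ v₁ v₂ v₃ hC hP4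
  have hw2 : 0 < (u₂ ^ 2 - ((u₁ ^ 2 + u₂ ^ 2 + u₃ ^ 2 + u₄ ^ 2 + u₅ ^ 2) - (v₁ ^ 2 + v₂ ^ 2 + v₃ ^ 2)) / 2) := by
    have h : 0 < (u₂ ^ 2 - ((u₁ ^ 2 + u₂ ^ 2 + u₃ ^ 2 + u₄ ^ 2 + u₅ ^ 2) - (v₁ ^ 2 + v₂ ^ 2 + v₃ ^ 2)) / 2) * ((u₂ - v₁) * (u₂ - v₂) * (u₂ - v₃)) := by rw [hq2]; exact hlu2
    exact pos_of_mul_pos_of_pos_right _ _ h hC2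
  have c41 : 0 < u₄ - v₁ := by linarith only [h₁, h₁₂, h₂, h₃, h₃', h₄, h₄₅]
  have c42 : 0 < u₄ - v₂ := by linarith only [h₁, h₁₂, h₂, h₃, h₃', h₄, h₄₅]
  have c43 : 0 < u₄ - v₃ := by linarith only [h₁, h₁₂, h₂, h₃, h₃', h₄, h₄₅]
  have hC4 : 0 < ((u₄ - v₁) * (u₄ - v₂) * (u₄ - v₃)) := (mul_pos (mul_pos c41 c42) c43)
  have hq4 := wall_eq_line₄ u₁ u₂ u₃ u₄ u₅ v₁ v₂ v₃ hC hP4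
  have hw4 : (u₄ ^ 2 - ((u₁ ^ 2 + u₂ ^ 2 + u₃ ^ 2 + u₄ ^ 2 + u₅ ^ 2) - (v₁ ^ 2 + v₂ ^ 2 + v₃ ^ 2)) / 2) < 0 := by
    have h : (u₄ ^ 2 - ((u₁ ^ 2 + u₂ ^ 2 + u₃ ^ 2 + u₄ ^ 2 + u₅ ^ 2) - (v₁ ^ 2 + v₂ ^ 2 + v₃ ^ 2)) / 2) * ((u₄ - v₁) * (u₄ - v₂) * (u₄ - v₃)) < 0 := by rw [hq4]; exact hlu4
    exact neg_of_mul_neg_of_pos _ _ h hC4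
  have c51 : 0 < u₅ - v₁ := by linarith only [h₁, h₁₂, h₂, h₃, h₃', h₄, h₄₅]
  have c52 : 0 < u₅ - v₂ := by linarith only [h₁, h₁₂, h₂, h₃, h₃', h₄, h₄₅]
  have c53 : 0 < u₅ - v₃ := by linarith only [h₁, h₁₂, h₂, h₃, h₃', h₄, h₄₅]
  have hC5 : 0 < ((u₅ - v₁) * (u₅ - v₂) * (u₅ - v₃)) := (mul_pos (mul_pos c51 c52) c53)
  have hq5 := wall_eq_line₅ u₁ u₂ u₃ u₄ u₅ v₁ v₂ v₃ hC hP4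
  have hw5 : (u₅ ^ 2 - ((u₁ ^ 2 + u₂ ^ 2 + u₃ ^ 2 + u₄ ^ 2 + u₅ ^ 2) - (v₁ ^ 2 + v₂ ^ 2 + v₃ ^ 2)) / 2) < 0 := by
    have h : (u₅ ^ 2 - ((u₁ ^ 2 + u₂ ^ 2 + u₃ ^ 2 + u₄ ^ 2 + u₅ ^ 2) - (v₁ ^ 2 + v₂ ^ 2 + v₃ ^ 2)) / 2) * ((u₅ - v₁) * (u₅ - v₂) * (u₅ - v₃)) < 0 := by rw [hq5]; exact hlu5
    exact neg_of_mul_neg_of_pos _ _ h hC5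
  have i4 := inside_of_wall_neg u₄ ρ ((u₁ ^ 2 + u₂ ^ 2 + u₃ ^ 2 + u₄ ^ 2 + u₅ ^ 2) - (v₁ ^ 2 + v₂ ^ 2 + v₃ ^ 2)) hρ hρ2 hw4
  have i5 := inside_of_wall_neg u₅ ρ ((u₁ ^ 2 + u₂ ^ 2 + u₃ ^ 2 + u₄ ^ 2 + u₅ ^ 2) - (v₁ ^ 2 + v₂ ^ 2 + v₃ ^ 2)) hρ hρ2 hw5
  exact ⟨lt_neg_of_wall_pos_of_lt u₂ u₄ ρ ((u₁ ^ 2 + u₂ ^ 2 + u₃ ^ 2 + u₄ ^ 2 + u₅ ^ 2) - (v₁ ^ 2 + v₂ ^ 2 + v₃ ^ 2)) hρ2 hw2 (by linarith only [h₁, h₁₂, h₂, h₃, h₃', h₄, h₄₅]) i4.2, i4.1, i5.2⟩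

set_option maxHeartbeats 1600000 in
/-- TYPE REDUCTION for (0,2,4) (`v₁ < u₁ ≤ u₂ < v₂ < u₃ ≤ u₄ < v₃ < u₅`, `Q₄ < 0`): `u₂ < −ρ`, `−ρ < u₃`, `u₄ < ρ` (six types remain: `−ρ` against `v₂`, and `ρ` against `v₃, u₅`). Charge data only. -/
theorem types_024 (u₁ u₂ u₃ u₄ u₅ v₁ v₂ v₃ ρ : ℝ)
    (hC : u₁ + u₂ + u₃ + u₄ + u₅ = v₁ + v₂ + v₃)
    (hP4 : (u₁ ^ 3 + u₂ ^ 3 + u₃ ^ 3 + u₄ ^ 3 + u₅ ^ 3) - (v₁ ^ 3 + v₂ ^ 3 + v₃ ^ 3) = 0)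
    (h₁ : v₁ < u₁) (h₁₂ : u₁ ≤ u₂) (h₂ : u₂ < v₂) (h₃ : v₂ < u₃) (h₃₄ : u₃ ≤ u₄) (h₄ : u₄ < v₃) (h₅ : v₃ < u₅)
    (hQ4 : 3 * ((u₁ ^ 4 + u₂ ^ 4 + u₃ ^ 4 + u₄ ^ 4 + u₅ ^ 4) - (v₁ ^ 4 + v₂ ^ 4 + v₃ ^ 4)) - (3 / 2) * ((u₁ ^ 2 + u₂ ^ 2 + u₃ ^ 2 + u₄ ^ 2 + u₅ ^ 2) - (v₁ ^ 2 + v₂ ^ 2 + v₃ ^ 2)) ^ 2 < 0)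
    (hρ : 0 ≤ ρ) (hρ2 : ρ ^ 2 = ((u₁ ^ 2 + u₂ ^ 2 + u₃ ^ 2 + u₄ ^ 2 + u₅ ^ 2) - (v₁ ^ 2 + v₂ ^ 2 + v₃ ^ 2)) / 2) :
    u₂ < -ρ ∧ -ρ < u₃ ∧ u₄ < ρ := by
  have hσ : (-((u₁ * u₂ * u₃ * u₄ + u₁ * u₂ * u₃ * u₅ + u₁ * u₂ * u₄ * u₅ + u₁ * u₃ * u₄ * u₅ + u₂ * u₃ * u₄ * u₅) + (v₁ * v₂ + v₁ * v₃ + v₂ * v₃) * ((u₁ ^ 2 + u₂ ^ 2 + u₃ ^ 2 + u₄ ^ 2 + u₅ ^ 2) - (v₁ ^ 2 + v₂ ^ 2 + v₃ ^ 2)) / 2)) < 0 := by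
    have e := Q4_eq_slope u₁ u₂ u₃ u₄ u₅ v₁ v₂ v₃ hC
    rw [hP4] at e
    linarith only [e, hQ4]
  have k21 : u₁ - v₂ < 0 := by linarith only [h₁, h₁₂, h₂, h₃, h₃₄, h₄, h₅]
  have k22 : u₂ - v₂ < 0 := by linarith only [h₁, h₁₂, h₂, h₃, h₃₄, h₄, h₅]
  have k23 : 0 < u₃ - v₂ := by linarith only [h₁, h₁₂, h₂, h₃, h₃₄, h₄, h₅]
  have k24 : 0 < u₄ - v₂ := by linarith only [h₁, h₁₂, h₂, h₃, h₃₄, h₄, h₅]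
  have k25 : 0 < u₅ - v₂ := by linarith only [h₁, h₁₂, h₂, h₃, h₃₄, h₄, h₅]
  have hK2 : 0 < (u₁ - v₂) * (u₂ - v₂) * (u₃ - v₂) * (u₄ - v₂) * (u₅ - v₂) := (mul_pos (mul_pos (mul_pos (mul_pos_of_neg_of_neg k21 k22) k23) k24) k25)

  have hl2 := K0_eq_line₂ u₁ u₂ u₃ u₄ u₅ v₁ v₂ v₃ hC hP4
  have k31 : u₁ - v₃ < 0 := by linarith only [h₁, h₁₂, h₂, h₃, h₃₄, h₄, h₅]
  have k32 : u₂ - v₃ < 0 := by linarith only [h₁, h₁₂, h₂, h₃, h₃₄, h₄, h₅]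
  have k33 : u₃ - v₃ < 0 := by linarith only [h₁, h₁₂, h₂, h₃, h₃₄, h₄, h₅]
  have k34 : u₄ - v₃ < 0 := by linarith only [h₁, h₁₂, h₂, h₃, h₃₄, h₄, h₅]
  have k35 : 0 < u₅ - v₃ := by linarith only [h₁, h₁₂, h₂, h₃, h₃₄, h₄, h₅]
  have hK3 : 0 < (u₁ - v₃) * (u₂ - v₃) * (u₃ - v₃) * (u₄ - v₃) * (u₅ - v₃) := (mul_pos (mul_pos_of_neg_of_neg (mul_neg_of_pos_of_neg (mul_pos_of_neg_of_neg k31 k32) k33) k34) k35)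

  have hl3 := K0_eq_line₃ u₁ u₂ u₃ u₄ u₅ v₁ v₂ v₃ hC hP4
  have eu2 : (((u₁ * u₂ * u₃ * u₄ * u₅) + (v₁ * v₂ * v₃) * ((u₁ ^ 2 + u₂ ^ 2 + u₃ ^ 2 + u₄ ^ 2 + u₅ ^ 2) - (v₁ ^ 2 + v₂ ^ 2 + v₃ ^ 2)) / 2) + (-((u₁ * u₂ * u₃ * u₄ + u₁ * u₂ * u₃ * u₅ + u₁ * u₂ * u₄ * u₅ + u₁ * u₃ * u₄ * u₅ + u₂ * u₃ * u₄ * u₅) + (v₁ * v₂ + v₁ * v₃ + v₂ * v₃) * ((u₁ ^ 2 + u₂ ^ 2 + u₃ ^ 2 + u₄ ^ 2 + u₅ ^ 2) - (v₁ ^ 2 + v₂ ^ 2 + v₃ ^ 2)) / 2)) * u₂) = (((u₁ * u₂ * u₃ * u₄ * u₅) + (v₁ * v₂ * v₃) * ((u₁ ^ 2 + u₂ ^ 2 + u₃ ^ 2 + u₄ ^ 2 + u₅ ^ 2) - (v₁ ^ 2 + v₂ ^ 2 + v₃ ^ 2)) / 2) + (-((u₁ * u₂ * u₃ * u₄ +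 u₁ * u₂ * u₃ * u₅ + u₁ * u₂ * u₄ * u₅ + u₁ * u₃ * u₄ * u₅ + u₂ * u₃ * u₄ * u₅) + (v₁ * v₂ + v₁ * v₃ + v₂ * v₃) * ((u₁ ^ 2 + u₂ ^ 2 + u₃ ^ 2 + u₄ ^ 2 + u₅ ^ 2) - (v₁ ^ 2 + v₂ ^ 2 + v₃ ^ 2)) / 2)) * v₂) + (-((u₁ * u₂ * u₃ * u₄ + u₁ * u₂ * u₃ * u₅ + u₁ * u₂ * u₄ * u₅ + u₁ * u₃ * u₄ * u₅ + u₂ * u₃ * u₄ * u₅) + (v₁ * v₂ + v₁ * v₃ + v₂ * v₃) * ((u₁ ^ 2 + u₂ ^ 2 + u₃ ^ 2 + u₄ ^ 2 + u₅ ^ 2) - (v₁ ^ 2 + v₂ ^ 2 + v₃ ^ 2)) / 2)) * (u₂ - v₂) := by ring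
  have hlu2 : 0 < (((u₁ * u₂ * u₃ * u₄ * u₅) + (v₁ * v₂ * v₃) * ((u₁ ^ 2 + u₂ ^ 2 + u₃ ^ 2 + u₄ ^ 2 + u₅ ^ 2) - (v₁ ^ 2 + v₂ ^ 2 + v₃ ^ 2)) / 2) + (-((u₁ * u₂ * u₃ * u₄ + u₁ * u₂ * u₃ * u₅ + u₁ * u₂ * u₄ * u₅ + u₁ * u₃ * u₄ * u₅ + u₂ * u₃ * u₄ * u₅) + (v₁ * v₂ + v₁ * v₃ + v₂ * v₃) * ((u₁ ^ 2 + u₂ ^ 2 + u₃ ^ 2 + u₄ ^ 2 + u₅ ^ 2) - (v₁ ^ 2 + v₂ ^ 2 + v₃ ^ 2)) / 2)) * u₂) := by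
    rw [eu2, ← hl2]
    have : 0 < (-((u₁ * u₂ * u₃ * u₄ + u₁ * u₂ * u₃ * u₅ + u₁ * u₂ * u₄ * u₅ + u₁ * u₃ * u₄ * u₅ + u₂ * u₃ * u₄ * u₅) + (v₁ * v₂ + v₁ * v₃ + v₂ * v₃) * ((u₁ ^ 2 + u₂ ^ 2 + u₃ ^ 2 + u₄ ^ 2 + u₅ ^ 2) - (v₁ ^ 2 + v₂ ^ 2 + v₃ ^ 2)) / 2)) * (u₂ - v₂) := mul_pos_of_neg_of_neg hσ (by linarith only [h₁, h₁₂, h₂, h₃, h₃₄, h₄, h₅])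
    linarith only [hK2, this]
  have eu3 : (((u₁ * u₂ * u₃ * u₄ * u₅) + (v₁ * v₂ * v₃) * ((u₁ ^ 2 + u₂ ^ 2 + u₃ ^ 2 + u₄ ^ 2 + u₅ ^ 2) - (v₁ ^ 2 + v₂ ^ 2 + v₃ ^ 2)) / 2) + (-((u₁ * u₂ * u₃ * u₄ + u₁ * u₂ * u₃ * u₅ + u₁ * u₂ * u₄ * u₅ + u₁ * u₃ * u₄ * u₅ + u₂ * u₃ * u₄ * u₅) + (v₁ * v₂ + v₁ * v₃ + v₂ * v₃) * ((u₁ ^ 2 + u₂ ^ 2 + u₃ ^ 2 + u₄ ^ 2 + u₅ ^ 2) - (v₁ ^ 2 + v₂ ^ 2 + v₃ ^ 2)) / 2)) * u₃) = (((u₁ * u₂ * u₃ * u₄ * u₅) + (v₁ * v₂ * v₃) * ((u₁ ^ 2 + u₂ ^ 2 + u₃ ^ 2 + u₄ ^ 2 + u₅ ^ 2) - (v₁ ^ 2 + v₂ ^ 2 + v₃ ^ 2)) / 2) + (-((u₁ * u₂ * u₃ * u₄ + u₁ * u₂ * u₃ * u₅ + u₁ * u₂ * u₄ * u₅ + u₁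 * u₃ * u₄ * u₅ + u₂ * u₃ * u₄ * u₅) + (v₁ * v₂ + v₁ * v₃ + v₂ * v₃) * ((u₁ ^ 2 + u₂ ^ 2 + u₃ ^ 2 + u₄ ^ 2 + u₅ ^ 2) - (v₁ ^ 2 + v₂ ^ 2 + v₃ ^ 2)) / 2)) * v₃) + (-((u₁ * u₂ * u₃ * u₄ + u₁ * u₂ * u₃ * u₅ + u₁ * u₂ * u₄ * u₅ + u₁ * u₃ * u₄ * u₅ + u₂ * u₃ * u₄ * u₅) + (v₁ * v₂ + v₁ * v₃ + v₂ * v₃) * ((u₁ ^ 2 + u₂ ^ 2 + u₃ ^ 2 + u₄ ^ 2 + u₅ ^ 2) - (v₁ ^ 2 + v₂ ^ 2 + v₃ ^ 2)) / 2)) * (u₃ - v₃) := by ring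
  have hlu3 : 0 < (((u₁ * u₂ * u₃ * u₄ * u₅) + (v₁ * v₂ * v₃) * ((u₁ ^ 2 + u₂ ^ 2 + u₃ ^ 2 + u₄ ^ 2 + u₅ ^ 2) - (v₁ ^ 2 + v₂ ^ 2 + v₃ ^ 2)) / 2) + (-((u₁ * u₂ * u₃ * u₄ + u₁ * u₂ * u₃ * u₅ + u₁ * u₂ * u₄ * u₅ + u₁ * u₃ * u₄ * u₅ + u₂ * u₃ * u₄ * u₅) + (v₁ * v₂ + v₁ * v₃ + v₂ * v₃) * ((u₁ ^ 2 + u₂ ^ 2 + u₃ ^ 2 + u₄ ^ 2 + u₅ ^ 2) - (v₁ ^ 2 + v₂ ^ 2 + v₃ ^ 2)) / 2)) * u₃) := by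
    rw [eu3, ← hl3]
    have : 0 < (-((u₁ * u₂ * u₃ * u₄ + u₁ * u₂ * u₃ * u₅ + u₁ * u₂ * u₄ * u₅ + u₁ * u₃ * u₄ * u₅ + u₂ * u₃ * u₄ * u₅) + (v₁ * v₂ + v₁ * v₃ + v₂ * v₃) * ((u₁ ^ 2 + u₂ ^ 2 + u₃ ^ 2 + u₄ ^ 2 + u₅ ^ 2) - (v₁ ^ 2 + v₂ ^ 2 + v₃ ^ 2)) / 2)) * (u₃ - v₃) := mul_pos_of_neg_of_neg hσ (by linarith only [h₁, h₁₂, h₂, h₃, h₃₄, h₄, h₅])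
    linarith only [hK3, this]
  have eu4 : (((u₁ * u₂ * u₃ * u₄ * u₅) + (v₁ * v₂ * v₃) * ((u₁ ^ 2 + u₂ ^ 2 + u₃ ^ 2 + u₄ ^ 2 + u₅ ^ 2) - (v₁ ^ 2 + v₂ ^ 2 + v₃ ^ 2)) / 2) + (-((u₁ * u₂ * u₃ * u₄ + u₁ * u₂ * u₃ * u₅ + u₁ * u₂ * u₄ * u₅ + u₁ * u₃ * u₄ * u₅ + u₂ * u₃ * u₄ * u₅) + (v₁ * v₂ + v₁ * v₃ + v₂ * v₃) * ((u₁ ^ 2 + u₂ ^ 2 + u₃ ^ 2 + u₄ ^ 2 + u₅ ^ 2) - (v₁ ^ 2 + v₂ ^ 2 + v₃ ^ 2)) / 2)) * u₄) = (((u₁ * u₂ * u₃ * u₄ * u₅) + (v₁ * v₂ * v₃) * ((u₁ ^ 2 + u₂ ^ 2 + u₃ ^ 2 + u₄ ^ 2 + u₅ ^ 2) - (v₁ ^ 2 + v₂ ^ 2 + v₃ ^ 2)) / 2) + (-((u₁ * u₂ * u₃ * u₄ + u₁ * u₂ * u₃ * u₅ + u₁ * u₂ * u₄ * u₅ + u₁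 * u₃ * u₄ * u₅ + u₂ * u₃ * u₄ * u₅) + (v₁ * v₂ + v₁ * v₃ + v₂ * v₃) * ((u₁ ^ 2 + u₂ ^ 2 + u₃ ^ 2 + u₄ ^ 2 + u₅ ^ 2) - (v₁ ^ 2 + v₂ ^ 2 + v₃ ^ 2)) / 2)) * v₃) + (-((u₁ * u₂ * u₃ * u₄ + u₁ * u₂ * u₃ * u₅ + u₁ * u₂ * u₄ * u₅ + u₁ * u₃ * u₄ * u₅ + u₂ * u₃ * u₄ * u₅) + (v₁ * v₂ + v₁ * v₃ + v₂ * v₃) * ((u₁ ^ 2 + u₂ ^ 2 + u₃ ^ 2 + u₄ ^ 2 + u₅ ^ 2) - (v₁ ^ 2 + v₂ ^ 2 + v₃ ^ 2)) / 2)) * (u₄ - v₃) := by ring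
  have hlu4 : 0 < (((u₁ * u₂ * u₃ * u₄ * u₅) + (v₁ * v₂ * v₃) * ((u₁ ^ 2 + u₂ ^ 2 + u₃ ^ 2 + u₄ ^ 2 + u₅ ^ 2) - (v₁ ^ 2 + v₂ ^ 2 + v₃ ^ 2)) / 2) + (-((u₁ * u₂ * u₃ * u₄ + u₁ * u₂ * u₃ * u₅ + u₁ * u₂ * u₄ * u₅ + u₁ * u₃ * u₄ * u₅ + u₂ * u₃ * u₄ * u₅) + (v₁ * v₂ + v₁ * v₃ + v₂ * v₃) * ((u₁ ^ 2 + u₂ ^ 2 + u₃ ^ 2 + u₄ ^ 2 + u₅ ^ 2) - (v₁ ^ 2 + v₂ ^ 2 + v₃ ^ 2)) / 2)) * u₄) := by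
    rw [eu4, ← hl3]
    have : 0 < (-((u₁ * u₂ * u₃ * u₄ + u₁ * u₂ * u₃ * u₅ + u₁ * u₂ * u₄ * u₅ + u₁ * u₃ * u₄ * u₅ + u₂ * u₃ * u₄ * u₅) + (v₁ * v₂ + v₁ * v₃ + v₂ * v₃) * ((u₁ ^ 2 + u₂ ^ 2 + u₃ ^ 2 + u₄ ^ 2 + u₅ ^ 2) - (v₁ ^ 2 + v₂ ^ 2 + v₃ ^ 2)) / 2)) * (u₄ - v₃) := mul_pos_of_neg_of_neg hσ (by linarith only [h₁, h₁₂, h₂, h₃, h₃₄, h₄, h₅])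
    linarith only [hK3, this]
  have c21 : 0 < u₂ - v₁ := by linarith only [h₁, h₁₂, h₂, h₃, h₃₄, h₄, h₅]
  have c22 : u₂ - v₂ < 0 := by linarith only [h₁, h₁₂, h₂, h₃, h₃₄, h₄, h₅]
  have c23 : u₂ - v₃ < 0 := by linarith only [h₁, h₁₂, h₂, h₃, h₃₄, h₄, h₅]
  have hC2 : 0 < ((u₂ - v₁) * (u₂ - v₂) * (u₂ - v₃)) := (mul_pos_of_neg_of_neg (mul_neg_of_pos_of_neg c21 c22) c23)
  have hq2 := wall_eq_line₂ u₁ u₂ u₃ u₄ u₅ v₁ v₂ v₃ hC hP4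
  have hw2 : 0 < (u₂ ^ 2 - ((u₁ ^ 2 + u₂ ^ 2 + u₃ ^ 2 + u₄ ^ 2 + u₅ ^ 2) - (v₁ ^ 2 + v₂ ^ 2 + v₃ ^ 2)) / 2) := by
    have h : 0 < (u₂ ^ 2 - ((u₁ ^ 2 + u₂ ^ 2 + u₃ ^ 2 + u₄ ^ 2 + u₅ ^ 2) - (v₁ ^ 2 + v₂ ^ 2 + v₃ ^ 2)) / 2) * ((u₂ - v₁) * (u₂ - v₂) * (u₂ - v₃)) := by rw [hq2]; exact hlu2
    exact pos_of_mul_pos_of_pos_right _ _ h hC2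
  have c31 : 0 < u₃ - v₁ := by linarith only [h₁, h₁₂, h₂, h₃, h₃₄, h₄, h₅]
  have c32 : 0 < u₃ - v₂ := by linarith only [h₁, h₁₂, h₂, h₃, h₃₄, h₄, h₅]
  have c33 : u₃ - v₃ < 0 := by linarith only [h₁, h₁₂, h₂, h₃, h₃₄, h₄, h₅]
  have hC3 : ((u₃ - v₁) * (u₃ - v₂) * (u₃ - v₃)) < 0 := (mul_neg_of_pos_of_neg (mul_pos c31 c32) c33)
  have hq3 := wall_eq_line₃ u₁ u₂ u₃ u₄ u₅ v₁ v₂ v₃ hC hP4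
  have hw3 : (u₃ ^ 2 - ((u₁ ^ 2 + u₂ ^ 2 + u₃ ^ 2 + u₄ ^ 2 + u₅ ^ 2) - (v₁ ^ 2 + v₂ ^ 2 + v₃ ^ 2)) / 2) < 0 := by
    have h : 0 < (u₃ ^ 2 - ((u₁ ^ 2 + u₂ ^ 2 + u₃ ^ 2 + u₄ ^ 2 + u₅ ^ 2) - (v₁ ^ 2 + v₂ ^ 2 + v₃ ^ 2)) / 2) * ((u₃ - v₁) * (u₃ - v₂) * (u₃ - v₃)) := by rw [hq3]; exact hlu3
    exact neg_of_mul_pos_of_neg _ _ h hC3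
  have c41 : 0 < u₄ - v₁ := by linarith only [h₁, h₁₂, h₂, h₃, h₃₄, h₄, h₅]
  have c42 : 0 < u₄ - v₂ := by linarith only [h₁, h₁₂, h₂, h₃, h₃₄, h₄, h₅]
  have c43 : u₄ - v₃ < 0 := by linarith only [h₁, h₁₂, h₂, h₃, h₃₄, h₄, h₅]
  have hC4 : ((u₄ - v₁) * (u₄ - v₂) * (u₄ - v₃)) < 0 := (mul_neg_of_pos_of_neg (mul_pos c41 c42) c43)
  have hq4 := wall_eq_line₄ u₁ u₂ u₃ u₄ u₅ v₁ v₂ v₃ hC hP4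
  have hw4 : (u₄ ^ 2 - ((u₁ ^ 2 + u₂ ^ 2 + u₃ ^ 2 + u₄ ^ 2 + u₅ ^ 2) - (v₁ ^ 2 + v₂ ^ 2 + v₃ ^ 2)) / 2) < 0 := by
    have h : 0 < (u₄ ^ 2 - ((u₁ ^ 2 + u₂ ^ 2 + u₃ ^ 2 + u₄ ^ 2 + u₅ ^ 2) - (v₁ ^ 2 + v₂ ^ 2 + v₃ ^ 2)) / 2) * ((u₄ - v₁) * (u₄ - v₂) * (u₄ - v₃)) := by rw [hq4]; exact hlu4
    exact neg_of_mul_pos_of_neg _ _ h hC4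
  have i3 := inside_of_wall_neg u₃ ρ ((u₁ ^ 2 + u₂ ^ 2 + u₃ ^ 2 + u₄ ^ 2 + u₅ ^ 2) - (v₁ ^ 2 + v₂ ^ 2 + v₃ ^ 2)) hρ hρ2 hw3
  have i4 := inside_of_wall_neg u₄ ρ ((u₁ ^ 2 + u₂ ^ 2 + u₃ ^ 2 + u₄ ^ 2 + u₅ ^ 2) - (v₁ ^ 2 + v₂ ^ 2 + v₃ ^ 2)) hρ hρ2 hw4
  exact ⟨lt_neg_of_wall_pos_of_lt u₂ u₃ ρ ((u₁ ^ 2 + u₂ ^ 2 + u₃ ^ 2 + u₄ ^ 2 + u₅ ^ 2) - (v₁ ^ 2 + v₂ ^ 2 + v₃ ^ 2)) hρ2 hw2 (by linarith only [h₁, h₁₂, h₂, h₃, h₃₄, h₄, h₅]) i3.2, i3.1, i4.2⟩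

set_option maxHeartbeats 1600000 in
/-- TYPE REDUCTION for (1,1,3) (`u₁ < v₁ ≤ v₂ < u₂ ≤ u₃ < v₃ < u₄ ≤ u₅`, `Q₄ < 0`): `u₃ < −ρ`, `−ρ < u₄`, `u₅ < ρ` (two types remain: `−ρ` against `v₃`). Charge data only. -/
theorem types_113 (u₁ u₂ u₃ u₄ u₅ v₁ v₂ v₃ ρ : ℝ)
    (hC : u₁ + u₂ + u₃ + u₄ + u₅ = v₁ + v₂ + v₃)
    (hP4 : (u₁ ^ 3 + u₂ ^ 3 + u₃ ^ 3 + u₄ ^ 3 + u₅ ^ 3) - (v₁ ^ 3 + v₂ ^ 3 + v₃ ^ 3) = 0)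
    (h₁ : u₁ < v₁) (h₁₂ : v₁ ≤ v₂) (h₂ : v₂ < u₂) (h₂₃ : u₂ ≤ u₃) (h₃ : u₃ < v₃) (h₄ : v₃ < u₄) (h₄₅ : u₄ ≤ u₅)
    (hQ4 : 3 * ((u₁ ^ 4 + u₂ ^ 4 + u₃ ^ 4 + u₄ ^ 4 + u₅ ^ 4) - (v₁ ^ 4 + v₂ ^ 4 + v₃ ^ 4)) - (3 / 2) * ((u₁ ^ 2 + u₂ ^ 2 + u₃ ^ 2 + u₄ ^ 2 + u₅ ^ 2) - (v₁ ^ 2 + v₂ ^ 2 + v₃ ^ 2)) ^ 2 < 0)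
    (hρ : 0 ≤ ρ) (hρ2 : ρ ^ 2 = ((u₁ ^ 2 + u₂ ^ 2 + u₃ ^ 2 + u₄ ^ 2 + u₅ ^ 2) - (v₁ ^ 2 + v₂ ^ 2 + v₃ ^ 2)) / 2) :
    u₃ < -ρ ∧ -ρ < u₄ ∧ u₅ < ρ := by
  have hσ : (-((u₁ * u₂ * u₃ * u₄ + u₁ * u₂ * u₃ * u₅ + u₁ * u₂ * u₄ * u₅ + u₁ * u₃ * u₄ * u₅ + u₂ * u₃ * u₄ * u₅) + (v₁ * v₂ + v₁ * v₃ + v₂ * v₃) * ((u₁ ^ 2 + u₂ ^ 2 + u₃ ^ 2 + u₄ ^ 2 + u₅ ^ 2) - (v₁ ^ 2 + v₂ ^ 2 + v₃ ^ 2)) / 2)) < 0 := by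
    have e := Q4_eq_slope u₁ u₂ u₃ u₄ u₅ v₁ v₂ v₃ hC
    rw [hP4] at e
    linarith only [e, hQ4]
  have k21 : u₁ - v₂ < 0 := by linarith only [h₁, h₁₂, h₂, h₂₃, h₃, h₄, h₄₅]
  have k22 : 0 < u₂ - v₂ := by linarith only [h₁, h₁₂, h₂, h₂₃, h₃, h₄, h₄₅]
  have k23 : 0 < u₃ - v₂ := by linarith only [h₁, h₁₂, h₂, h₂₃, h₃, h₄, h₄₅]
  have k24 : 0 < u₄ - v₂ := by linarith only [h₁, h₁₂, h₂, h₂₃, h₃, h₄, h₄₅]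
  have k25 : 0 < u₅ - v₂ := by linarith only [h₁, h₁₂, h₂, h₂₃, h₃, h₄, h₄₅]
  have hK2 : (u₁ - v₂) * (u₂ - v₂) * (u₃ - v₂) * (u₄ - v₂) * (u₅ - v₂) < 0 := (mul_neg_of_neg_of_pos (mul_neg_of_neg_of_pos (mul_neg_of_neg_of_pos (mul_neg_of_neg_of_pos k21 k22) k23) k24) k25)

  have hl2 := K0_eq_line₂ u₁ u₂ u₃ u₄ u₅ v₁ v₂ v₃ hC hP4
  have k31 : u₁ - v₃ < 0 := by linarith only [h₁, h₁₂, h₂, h₂₃, h₃, h₄, h₄₅]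
  have k32 : u₂ - v₃ < 0 := by linarith only [h₁, h₁₂, h₂, h₂₃, h₃, h₄, h₄₅]
  have k33 : u₃ - v₃ < 0 := by linarith only [h₁, h₁₂, h₂, h₂₃, h₃, h₄, h₄₅]
  have k34 : 0 < u₄ - v₃ := by linarith only [h₁, h₁₂, h₂, h₂₃, h₃, h₄, h₄₅]
  have k35 : 0 < u₅ - v₃ := by linarith only [h₁, h₁₂, h₂, h₂₃, h₃, h₄, h₄₅]
  have hK3 : (u₁ - v₃) * (u₂ - v₃) * (u₃ - v₃) * (u₄ - v₃) * (u₅ - v₃) < 0 := (mul_neg_of_neg_of_pos (mul_neg_of_neg_of_pos (mul_neg_of_pos_of_neg (mul_pos_of_neg_of_neg k31 k32) k33) k34) k35)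

  have hl3 := K0_eq_line₃ u₁ u₂ u₃ u₄ u₅ v₁ v₂ v₃ hC hP4
  have eu2 : (((u₁ * u₂ * u₃ * u₄ * u₅) + (v₁ * v₂ * v₃) * ((u₁ ^ 2 + u₂ ^ 2 + u₃ ^ 2 + u₄ ^ 2 + u₅ ^ 2) - (v₁ ^ 2 + v₂ ^ 2 + v₃ ^ 2)) / 2) + (-((u₁ * u₂ * u₃ * u₄ + u₁ * u₂ * u₃ * u₅ + u₁ * u₂ * u₄ * u₅ + u₁ * u₃ * u₄ * u₅ + u₂ * u₃ * u₄ * u₅) + (v₁ * v₂ + v₁ * v₃ + v₂ * v₃) * ((u₁ ^ 2 + u₂ ^ 2 + u₃ ^ 2 + u₄ ^ 2 + u₅ ^ 2) - (v₁ ^ 2 + v₂ ^ 2 + v₃ ^ 2)) / 2)) * u₂) = (((u₁ * u₂ * u₃ * u₄ * u₅) + (v₁ * v₂ * v₃) * ((u₁ ^ 2 + u₂ ^ 2 + u₃ ^ 2 + u₄ ^ 2 + u₅ ^ 2) - (v₁ ^ 2 + v₂ ^ 2 + v₃ ^ 2)) / 2) + (-((u₁ * u₂ * u₃ * u₄ +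 u₁ * u₂ * u₃ * u₅ + u₁ * u₂ * u₄ * u₅ + u₁ * u₃ * u₄ * u₅ + u₂ * u₃ * u₄ * u₅) + (v₁ * v₂ + v₁ * v₃ + v₂ * v₃) * ((u₁ ^ 2 + u₂ ^ 2 + u₃ ^ 2 + u₄ ^ 2 + u₅ ^ 2) - (v₁ ^ 2 + v₂ ^ 2 + v₃ ^ 2)) / 2)) * v₂) + (-((u₁ * u₂ * u₃ * u₄ + u₁ * u₂ * u₃ * u₅ + u₁ * u₂ * u₄ * u₅ + u₁ * u₃ * u₄ * u₅ + u₂ * u₃ * u₄ * u₅) + (v₁ * v₂ + v₁ * v₃ + v₂ * v₃) * ((u₁ ^ 2 + u₂ ^ 2 + u₃ ^ 2 + u₄ ^ 2 + u₅ ^ 2) - (v₁ ^ 2 + v₂ ^ 2 + v₃ ^ 2)) / 2)) * (u₂ - v₂) := by ring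
  have hlu2 : (((u₁ * u₂ * u₃ * u₄ * u₅) + (v₁ * v₂ * v₃) * ((u₁ ^ 2 + u₂ ^ 2 + u₃ ^ 2 + u₄ ^ 2 + u₅ ^ 2) - (v₁ ^ 2 + v₂ ^ 2 + v₃ ^ 2)) / 2) + (-((u₁ * u₂ * u₃ * u₄ + u₁ * u₂ * u₃ * u₅ + u₁ * u₂ * u₄ * u₅ + u₁ * u₃ * u₄ * u₅ + u₂ * u₃ * u₄ * u₅) + (v₁ * v₂ + v₁ * v₃ + v₂ * v₃) * ((u₁ ^ 2 + u₂ ^ 2 + u₃ ^ 2 + u₄ ^ 2 + u₅ ^ 2) - (v₁ ^ 2 + v₂ ^ 2 + v₃ ^ 2)) / 2)) * u₂) < 0 := by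
    rw [eu2, ← hl2]
    have : (-((u₁ * u₂ * u₃ * u₄ + u₁ * u₂ * u₃ * u₅ + u₁ * u₂ * u₄ * u₅ + u₁ * u₃ * u₄ * u₅ + u₂ * u₃ * u₄ * u₅) + (v₁ * v₂ + v₁ * v₃ + v₂ * v₃) * ((u₁ ^ 2 + u₂ ^ 2 + u₃ ^ 2 + u₄ ^ 2 + u₅ ^ 2) - (v₁ ^ 2 + v₂ ^ 2 + v₃ ^ 2)) / 2)) * (u₂ - v₂) < 0 := mul_neg_of_neg_of_pos hσ (by linarith only [h₁, h₁₂, h₂, h₂₃, h₃, h₄, h₄₅])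
    linarith only [hK2, this]
  have eu3 : (((u₁ * u₂ * u₃ * u₄ * u₅) + (v₁ * v₂ * v₃) * ((u₁ ^ 2 + u₂ ^ 2 + u₃ ^ 2 + u₄ ^ 2 + u₅ ^ 2) - (v₁ ^ 2 + v₂ ^ 2 + v₃ ^ 2)) / 2) + (-((u₁ * u₂ * u₃ * u₄ + u₁ * u₂ * u₃ * u₅ + u₁ * u₂ * u₄ * u₅ + u₁ * u₃ * u₄ * u₅ + u₂ * u₃ * u₄ * u₅) + (v₁ * v₂ + v₁ * v₃ + v₂ * v₃) * ((u₁ ^ 2 + u₂ ^ 2 + u₃ ^ 2 + u₄ ^ 2 + u₅ ^ 2) - (v₁ ^ 2 + v₂ ^ 2 + v₃ ^ 2)) / 2)) * u₃) = (((u₁ * u₂ * u₃ * u₄ * u₅) + (v₁ * v₂ * v₃) * ((u₁ ^ 2 + u₂ ^ 2 + u₃ ^ 2 + u₄ ^ 2 + u₅ ^ 2) - (v₁ ^ 2 + v₂ ^ 2 + v₃ ^ 2)) / 2) + (-((u₁ * u₂ * u₃ * u₄ + u₁ * u₂ * u₃ * u₅ + u₁ * u₂ * u₄ * u₅ + u₁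 * u₃ * u₄ * u₅ + u₂ * u₃ * u₄ * u₅) + (v₁ * v₂ + v₁ * v₃ + v₂ * v₃) * ((u₁ ^ 2 + u₂ ^ 2 + u₃ ^ 2 + u₄ ^ 2 + u₅ ^ 2) - (v₁ ^ 2 + v₂ ^ 2 + v₃ ^ 2)) / 2)) * v₂) + (-((u₁ * u₂ * u₃ * u₄ + u₁ * u₂ * u₃ * u₅ + u₁ * u₂ * u₄ * u₅ + u₁ * u₃ * u₄ * u₅ + u₂ * u₃ * u₄ * u₅) + (v₁ * v₂ + v₁ * v₃ + v₂ * v₃) * ((u₁ ^ 2 + u₂ ^ 2 + u₃ ^ 2 + u₄ ^ 2 + u₅ ^ 2) - (v₁ ^ 2 + v₂ ^ 2 + v₃ ^ 2)) / 2)) * (u₃ - v₂) := by ring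
  have hlu3 : (((u₁ * u₂ * u₃ * u₄ * u₅) + (v₁ * v₂ * v₃) * ((u₁ ^ 2 + u₂ ^ 2 + u₃ ^ 2 + u₄ ^ 2 + u₅ ^ 2) - (v₁ ^ 2 + v₂ ^ 2 + v₃ ^ 2)) / 2) + (-((u₁ * u₂ * u₃ * u₄ + u₁ * u₂ * u₃ * u₅ + u₁ * u₂ * u₄ * u₅ + u₁ * u₃ * u₄ * u₅ + u₂ * u₃ * u₄ * u₅) + (v₁ * v₂ + v₁ * v₃ + v₂ * v₃) * ((u₁ ^ 2 + u₂ ^ 2 + u₃ ^ 2 + u₄ ^ 2 + u₅ ^ 2) - (v₁ ^ 2 + v₂ ^ 2 + v₃ ^ 2)) / 2)) * u₃) < 0 := by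
    rw [eu3, ← hl2]
    have : (-((u₁ * u₂ * u₃ * u₄ + u₁ * u₂ * u₃ * u₅ + u₁ * u₂ * u₄ * u₅ + u₁ * u₃ * u₄ * u₅ + u₂ * u₃ * u₄ * u₅) + (v₁ * v₂ + v₁ * v₃ + v₂ * v₃) * ((u₁ ^ 2 + u₂ ^ 2 + u₃ ^ 2 + u₄ ^ 2 + u₅ ^ 2) - (v₁ ^ 2 + v₂ ^ 2 + v₃ ^ 2)) / 2)) * (u₃ - v₂) < 0 := mul_neg_of_neg_of_pos hσ (by linarith only [h₁, h₁₂, h₂, h₂₃, h₃, h₄, h₄₅])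
    linarith only [hK2, this]
  have eu4 : (((u₁ * u₂ * u₃ * u₄ * u₅) + (v₁ * v₂ * v₃) * ((u₁ ^ 2 + u₂ ^ 2 + u₃ ^ 2 + u₄ ^ 2 + u₅ ^ 2) - (v₁ ^ 2 + v₂ ^ 2 + v₃ ^ 2)) / 2) + (-((u₁ * u₂ * u₃ * u₄ + u₁ * u₂ * u₃ * u₅ + u₁ * u₂ * u₄ * u₅ + u₁ * u₃ * u₄ * u₅ + u₂ * u₃ * u₄ * u₅) + (v₁ * v₂ + v₁ * v₃ + v₂ * v₃) * ((u₁ ^ 2 + u₂ ^ 2 + u₃ ^ 2 + u₄ ^ 2 + u₅ ^ 2) - (v₁ ^ 2 + v₂ ^ 2 + v₃ ^ 2)) / 2)) * u₄) = (((u₁ * u₂ * u₃ * u₄ * u₅) + (v₁ * v₂ * v₃) * ((u₁ ^ 2 + u₂ ^ 2 + u₃ ^ 2 + u₄ ^ 2 + u₅ ^ 2) - (v₁ ^ 2 + v₂ ^ 2 + v₃ ^ 2)) / 2) + (-((u₁ * u₂ * u₃ * u₄ + u₁ * u₂ * u₃ * u₅ + u₁ * u₂ * u₄ * u₅ + u₁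 * u₃ * u₄ * u₅ + u₂ * u₃ * u₄ * u₅) + (v₁ * v₂ + v₁ * v₃ + v₂ * v₃) * ((u₁ ^ 2 + u₂ ^ 2 + u₃ ^ 2 + u₄ ^ 2 + u₅ ^ 2) - (v₁ ^ 2 + v₂ ^ 2 + v₃ ^ 2)) / 2)) * v₃) + (-((u₁ * u₂ * u₃ * u₄ + u₁ * u₂ * u₃ * u₅ + u₁ * u₂ * u₄ * u₅ + u₁ * u₃ * u₄ * u₅ + u₂ * u₃ * u₄ * u₅) + (v₁ * v₂ + v₁ * v₃ + v₂ * v₃) * ((u₁ ^ 2 + u₂ ^ 2 + u₃ ^ 2 + u₄ ^ 2 + u₅ ^ 2) - (v₁ ^ 2 + v₂ ^ 2 + v₃ ^ 2)) / 2)) * (u₄ - v₃) := by ring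
  have hlu4 : (((u₁ * u₂ * u₃ * u₄ * u₅) + (v₁ * v₂ * v₃) * ((u₁ ^ 2 + u₂ ^ 2 + u₃ ^ 2 + u₄ ^ 2 + u₅ ^ 2) - (v₁ ^ 2 + v₂ ^ 2 + v₃ ^ 2)) / 2) + (-((u₁ * u₂ * u₃ * u₄ + u₁ * u₂ * u₃ * u₅ + u₁ * u₂ * u₄ * u₅ + u₁ * u₃ * u₄ * u₅ + u₂ * u₃ * u₄ * u₅) + (v₁ * v₂ + v₁ * v₃ + v₂ * v₃) * ((u₁ ^ 2 + u₂ ^ 2 + u₃ ^ 2 + u₄ ^ 2 + u₅ ^ 2) - (v₁ ^ 2 + v₂ ^ 2 + v₃ ^ 2)) / 2)) * u₄) < 0 := by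
    rw [eu4, ← hl3]
    have : (-((u₁ * u₂ * u₃ * u₄ + u₁ * u₂ * u₃ * u₅ + u₁ * u₂ * u₄ * u₅ + u₁ * u₃ * u₄ * u₅ + u₂ * u₃ * u₄ * u₅) + (v₁ * v₂ + v₁ * v₃ + v₂ * v₃) * ((u₁ ^ 2 + u₂ ^ 2 + u₃ ^ 2 + u₄ ^ 2 + u₅ ^ 2) - (v₁ ^ 2 + v₂ ^ 2 + v₃ ^ 2)) / 2)) * (u₄ - v₃) < 0 := mul_neg_of_neg_of_pos hσ (by linarith only [h₁, h₁₂, h₂, h₂₃, h₃, h₄, h₄₅])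
    linarith only [hK3, this]
  have eu5 : (((u₁ * u₂ * u₃ * u₄ * u₅) + (v₁ * v₂ * v₃) * ((u₁ ^ 2 + u₂ ^ 2 + u₃ ^ 2 + u₄ ^ 2 + u₅ ^ 2) - (v₁ ^ 2 + v₂ ^ 2 + v₃ ^ 2)) / 2) + (-((u₁ * u₂ * u₃ * u₄ + u₁ * u₂ * u₃ * u₅ + u₁ * u₂ * u₄ * u₅ + u₁ * u₃ * u₄ * u₅ + u₂ * u₃ * u₄ * u₅) + (v₁ * v₂ + v₁ * v₃ + v₂ * v₃) * ((u₁ ^ 2 + u₂ ^ 2 + u₃ ^ 2 + u₄ ^ 2 + u₅ ^ 2) - (v₁ ^ 2 + v₂ ^ 2 + v₃ ^ 2)) / 2)) * u₅) = (((u₁ * u₂ * u₃ * u₄ * u₅) + (v₁ * v₂ * v₃) * ((u₁ ^ 2 + u₂ ^ 2 + u₃ ^ 2 + u₄ ^ 2 + u₅ ^ 2) - (v₁ ^ 2 + v₂ ^ 2 + v₃ ^ 2)) / 2) + (-((u₁ * u₂ * u₃ * u₄ + u₁ * u₂ * u₃ * u₅ + u₁ * u₂ * u₄ * u₅ + u₁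 * u₃ * u₄ * u₅ + u₂ * u₃ * u₄ * u₅) + (v₁ * v₂ + v₁ * v₃ + v₂ * v₃) * ((u₁ ^ 2 + u₂ ^ 2 + u₃ ^ 2 + u₄ ^ 2 + u₅ ^ 2) - (v₁ ^ 2 + v₂ ^ 2 + v₃ ^ 2)) / 2)) * v₃) + (-((u₁ * u₂ * u₃ * u₄ + u₁ * u₂ * u₃ * u₅ + u₁ * u₂ * u₄ * u₅ + u₁ * u₃ * u₄ * u₅ + u₂ * u₃ * u₄ * u₅) + (v₁ * v₂ + v₁ * v₃ + v₂ * v₃) * ((u₁ ^ 2 + u₂ ^ 2 + u₃ ^ 2 + u₄ ^ 2 + u₅ ^ 2) - (v₁ ^ 2 + v₂ ^ 2 + v₃ ^ 2)) / 2)) * (u₅ - v₃) := by ring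
  have hlu5 : (((u₁ * u₂ * u₃ * u₄ * u₅) + (v₁ * v₂ * v₃) * ((u₁ ^ 2 + u₂ ^ 2 + u₃ ^ 2 + u₄ ^ 2 + u₅ ^ 2) - (v₁ ^ 2 + v₂ ^ 2 + v₃ ^ 2)) / 2) + (-((u₁ * u₂ * u₃ * u₄ + u₁ * u₂ * u₃ * u₅ + u₁ * u₂ * u₄ * u₅ + u₁ * u₃ * u₄ * u₅ + u₂ * u₃ * u₄ * u₅) + (v₁ * v₂ + v₁ * v₃ + v₂ * v₃) * ((u₁ ^ 2 + u₂ ^ 2 + u₃ ^ 2 + u₄ ^ 2 + u₅ ^ 2) - (v₁ ^ 2 + v₂ ^ 2 + v₃ ^ 2)) / 2)) * u₅) < 0 := by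
    rw [eu5, ← hl3]
    have : (-((u₁ * u₂ * u₃ * u₄ + u₁ * u₂ * u₃ * u₅ + u₁ * u₂ * u₄ * u₅ + u₁ * u₃ * u₄ * u₅ + u₂ * u₃ * u₄ * u₅) + (v₁ * v₂ + v₁ * v₃ + v₂ * v₃) * ((u₁ ^ 2 + u₂ ^ 2 + u₃ ^ 2 + u₄ ^ 2 + u₅ ^ 2) - (v₁ ^ 2 + v₂ ^ 2 + v₃ ^ 2)) / 2)) * (u₅ - v₃) < 0 := mul_neg_of_neg_of_pos hσ (by linarith only [h₁, h₁₂, h₂, h₂₃, h₃, h₄, h₄₅])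
    linarith only [hK3, this]
  have c31 : 0 < u₃ - v₁ := by linarith only [h₁, h₁₂, h₂, h₂₃, h₃, h₄, h₄₅]
  have c32 : 0 < u₃ - v₂ := by linarith only [h₁, h₁₂, h₂, h₂₃, h₃, h₄, h₄₅]
  have c33 : u₃ - v₃ < 0 := by linarith only [h₁, h₁₂, h₂, h₂₃, h₃, h₄, h₄₅]
  have hC3 : ((u₃ - v₁) * (u₃ - v₂) * (u₃ - v₃)) < 0 := (mul_neg_of_pos_of_neg (mul_pos c31 c32) c33)
  have hq3 := wall_eq_line₃ u₁ u₂ u₃ u₄ u₅ v₁ v₂ v₃ hC hP4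
  have hw3 : 0 < (u₃ ^ 2 - ((u₁ ^ 2 + u₂ ^ 2 + u₃ ^ 2 + u₄ ^ 2 + u₅ ^ 2) - (v₁ ^ 2 + v₂ ^ 2 + v₃ ^ 2)) / 2) := by
    have h : (u₃ ^ 2 - ((u₁ ^ 2 + u₂ ^ 2 + u₃ ^ 2 + u₄ ^ 2 + u₅ ^ 2) - (v₁ ^ 2 + v₂ ^ 2 + v₃ ^ 2)) / 2) * ((u₃ - v₁) * (u₃ - v₂) * (u₃ - v₃)) < 0 := by rw [hq3]; exact hlu3
    exact pos_of_mul_neg_of_neg _ _ h hC3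
  have c41 : 0 < u₄ - v₁ := by linarith only [h₁, h₁₂, h₂, h₂₃, h₃, h₄, h₄₅]
  have c42 : 0 < u₄ - v₂ := by linarith only [h₁, h₁₂, h₂, h₂₃, h₃, h₄, h₄₅]
  have c43 : 0 < u₄ - v₃ := by linarith only [h₁, h₁₂, h₂, h₂₃, h₃, h₄, h₄₅]
  have hC4 : 0 < ((u₄ - v₁) * (u₄ - v₂) * (u₄ - v₃)) := (mul_pos (mul_pos c41 c42) c43)
  have hq4 := wall_eq_line₄ u₁ u₂ u₃ u₄ u₅ v₁ v₂ v₃ hC hP4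
  have hw4 : (u₄ ^ 2 - ((u₁ ^ 2 + u₂ ^ 2 + u₃ ^ 2 + u₄ ^ 2 + u₅ ^ 2) - (v₁ ^ 2 + v₂ ^ 2 + v₃ ^ 2)) / 2) < 0 := by
    have h : (u₄ ^ 2 - ((u₁ ^ 2 + u₂ ^ 2 + u₃ ^ 2 + u₄ ^ 2 + u₅ ^ 2) - (v₁ ^ 2 + v₂ ^ 2 + v₃ ^ 2)) / 2) * ((u₄ - v₁) * (u₄ - v₂) * (u₄ - v₃)) < 0 := by rw [hq4]; exact hlu4
    exact neg_of_mul_neg_of_pos _ _ h hC4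
  have c51 : 0 < u₅ - v₁ := by linarith only [h₁, h₁₂, h₂, h₂₃, h₃, h₄, h₄₅]
  have c52 : 0 < u₅ - v₂ := by linarith only [h₁, h₁₂, h₂, h₂₃, h₃, h₄, h₄₅]
  have c53 : 0 < u₅ - v₃ := by linarith only [h₁, h₁₂, h₂, h₂₃, h₃, h₄, h₄₅]
  have hC5 : 0 < ((u₅ - v₁) * (u₅ - v₂) * (u₅ - v₃)) := (mul_pos (mul_pos c51 c52) c53)
  have hq5 := wall_eq_line₅ u₁ u₂ u₃ u₄ u₅ v₁ v₂ v₃ hC hP4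
  have hw5 : (u₅ ^ 2 - ((u₁ ^ 2 + u₂ ^ 2 + u₃ ^ 2 + u₄ ^ 2 + u₅ ^ 2) - (v₁ ^ 2 + v₂ ^ 2 + v₃ ^ 2)) / 2) < 0 := by
    have h : (u₅ ^ 2 - ((u₁ ^ 2 + u₂ ^ 2 + u₃ ^ 2 + u₄ ^ 2 + u₅ ^ 2) - (v₁ ^ 2 + v₂ ^ 2 + v₃ ^ 2)) / 2) * ((u₅ - v₁) * (u₅ - v₂) * (u₅ - v₃)) < 0 := by rw [hq5]; exact hlu5
    exact neg_of_mul_neg_of_pos _ _ h hC5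
  have i4 := inside_of_wall_neg u₄ ρ ((u₁ ^ 2 + u₂ ^ 2 + u₃ ^ 2 + u₄ ^ 2 + u₅ ^ 2) - (v₁ ^ 2 + v₂ ^ 2 + v₃ ^ 2)) hρ hρ2 hw4
  have i5 := inside_of_wall_neg u₅ ρ ((u₁ ^ 2 + u₂ ^ 2 + u₃ ^ 2 + u₄ ^ 2 + u₅ ^ 2) - (v₁ ^ 2 + v₂ ^ 2 + v₃ ^ 2)) hρ hρ2 hw5
  exact ⟨lt_neg_of_wall_pos_of_lt u₃ u₄ ρ ((u₁ ^ 2 + u₂ ^ 2 + u₃ ^ 2 + u₄ ^ 2 + u₅ ^ 2) - (v₁ ^ 2 + v₂ ^ 2 + v₃ ^ 2)) hρ2 hw3 (by linarith only [h₁, h₁₂, h₂, h₂₃, h₃, h₄, h₄₅]) i4.2, i4.1, i5.2⟩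

set_option maxHeartbeats 1600000 in
/-- TYPE REDUCTION for (1,3,3), charge part (`u₁ < v₁ < u₂ ≤ u₃ < v₂ ≤ v₃ < u₄ ≤ u₅`, `Q₄ < 0`): `−ρ < u₂` and `u₅ < ρ` (the charges `u₂, …, u₅` are inside `(−ρ, ρ)`). -/
theorem types_133_core (u₁ u₂ u₃ u₄ u₅ v₁ v₂ v₃ ρ : ℝ)
    (hC : u₁ + u₂ + u₃ + u₄ + u₅ = v₁ + v₂ + v₃)
    (hP4 : (u₁ ^ 3 + u₂ ^ 3 + u₃ ^ 3 + u₄ ^ 3 + u₅ ^ 3) - (v₁ ^ 3 + v₂ ^ 3 + v₃ ^ 3) = 0)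
    (h₁ : u₁ < v₁) (h₂ : v₁ < u₂) (h₂₃ : u₂ ≤ u₃) (h₃ : u₃ < v₂) (h₃₃ : v₂ ≤ v₃) (h₄ : v₃ < u₄) (h₄₅ : u₄ ≤ u₅)
    (hQ4 : 3 * ((u₁ ^ 4 + u₂ ^ 4 + u₃ ^ 4 + u₄ ^ 4 + u₅ ^ 4) - (v₁ ^ 4 + v₂ ^ 4 + v₃ ^ 4)) - (3 / 2) * ((u₁ ^ 2 + u₂ ^ 2 + u₃ ^ 2 + u₄ ^ 2 + u₅ ^ 2) - (v₁ ^ 2 + v₂ ^ 2 + v₃ ^ 2)) ^ 2 < 0)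
    (hρ : 0 ≤ ρ) (hρ2 : ρ ^ 2 = ((u₁ ^ 2 + u₂ ^ 2 + u₃ ^ 2 + u₄ ^ 2 + u₅ ^ 2) - (v₁ ^ 2 + v₂ ^ 2 + v₃ ^ 2)) / 2) :
    -ρ < u₂ ∧ u₅ < ρ := by
  have hσ : (-((u₁ * u₂ * u₃ * u₄ + u₁ * u₂ * u₃ * u₅ + u₁ * u₂ * u₄ * u₅ + u₁ * u₃ * u₄ * u₅ + u₂ * u₃ * u₄ * u₅) + (v₁ * v₂ + v₁ * v₃ + v₂ * v₃) * ((u₁ ^ 2 + u₂ ^ 2 + u₃ ^ 2 + u₄ ^ 2 + u₅ ^ 2) - (v₁ ^ 2 + v₂ ^ 2 + v₃ ^ 2)) / 2)) < 0 := by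
    have e := Q4_eq_slope u₁ u₂ u₃ u₄ u₅ v₁ v₂ v₃ hC
    rw [hP4] at e
    linarith only [e, hQ4]
  have k11 : u₁ - v₁ < 0 := by linarith only [h₁, h₂, h₂₃, h₃, h₃₃, h₄, h₄₅]
  have k12 : 0 < u₂ - v₁ := by linarith only [h₁, h₂, h₂₃, h₃, h₃₃, h₄, h₄₅]
  have k13 : 0 < u₃ - v₁ := by linarith only [h₁, h₂, h₂₃, h₃, h₃₃, h₄, h₄₅]
  have k14 : 0 < u₄ - v₁ := by linarith only [h₁, h₂, h₂₃, h₃, h₃₃, h₄, h₄₅]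
  have k15 : 0 < u₅ - v₁ := by linarith only [h₁, h₂, h₂₃, h₃, h₃₃, h₄, h₄₅]
  have hK1 : (u₁ - v₁) * (u₂ - v₁) * (u₃ - v₁) * (u₄ - v₁) * (u₅ - v₁) < 0 := (mul_neg_of_neg_of_pos (mul_neg_of_neg_of_pos (mul_neg_of_neg_of_pos (mul_neg_of_neg_of_pos k11 k12) k13) k14) k15)

  have hl1 := K0_eq_line₁ u₁ u₂ u₃ u₄ u₅ v₁ v₂ v₃ hC hP4
  have k31 : u₁ - v₃ < 0 := by linarith only [h₁, h₂, h₂₃, h₃, h₃₃, h₄, h₄₅]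
  have k32 : u₂ - v₃ < 0 := by linarith only [h₁, h₂, h₂₃, h₃, h₃₃, h₄, h₄₅]
  have k33 : u₃ - v₃ < 0 := by linarith only [h₁, h₂, h₂₃, h₃, h₃₃, h₄, h₄₅]
  have k34 : 0 < u₄ - v₃ := by linarith only [h₁, h₂, h₂₃, h₃, h₃₃, h₄, h₄₅]
  have k35 : 0 < u₅ - v₃ := by linarith only [h₁, h₂, h₂₃, h₃, h₃₃, h₄, h₄₅]
  have hK3 : (u₁ - v₃) * (u₂ - v₃) * (u₃ - v₃) * (u₄ - v₃) * (u₅ - v₃) < 0 := (mul_neg_of_neg_of_pos (mul_neg_of_neg_of_pos (mul_neg_of_pos_of_neg (mul_pos_of_neg_of_neg k31 k32) k33) k34) k35)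

  have hl3 := K0_eq_line₃ u₁ u₂ u₃ u₄ u₅ v₁ v₂ v₃ hC hP4
  have eu2 : (((u₁ * u₂ * u₃ * u₄ * u₅) + (v₁ * v₂ * v₃) * ((u₁ ^ 2 + u₂ ^ 2 + u₃ ^ 2 + u₄ ^ 2 + u₅ ^ 2) - (v₁ ^ 2 + v₂ ^ 2 + v₃ ^ 2)) / 2) + (-((u₁ * u₂ * u₃ * u₄ + u₁ * u₂ * u₃ * u₅ + u₁ * u₂ * u₄ * u₅ + u₁ * u₃ * u₄ * u₅ + u₂ * u₃ * u₄ * u₅) + (v₁ * v₂ + v₁ * v₃ + v₂ * v₃) * ((u₁ ^ 2 + u₂ ^ 2 + u₃ ^ 2 + u₄ ^ 2 + u₅ ^ 2) - (v₁ ^ 2 + v₂ ^ 2 + v₃ ^ 2)) / 2)) * u₂) = (((u₁ * u₂ * u₃ * u₄ * u₅) + (v₁ * v₂ * v₃) * ((u₁ ^ 2 + u₂ ^ 2 + u₃ ^ 2 + u₄ ^ 2 + u₅ ^ 2) - (v₁ ^ 2 + v₂ ^ 2 + v₃ ^ 2)) / 2) + (-((u₁ * u₂ * u₃ * u₄ +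 u₁ * u₂ * u₃ * u₅ + u₁ * u₂ * u₄ * u₅ + u₁ * u₃ * u₄ * u₅ + u₂ * u₃ * u₄ * u₅) + (v₁ * v₂ + v₁ * v₃ + v₂ * v₃) * ((u₁ ^ 2 + u₂ ^ 2 + u₃ ^ 2 + u₄ ^ 2 + u₅ ^ 2) - (v₁ ^ 2 + v₂ ^ 2 + v₃ ^ 2)) / 2)) * v₁) + (-((u₁ * u₂ * u₃ * u₄ + u₁ * u₂ * u₃ * u₅ + u₁ * u₂ * u₄ * u₅ + u₁ * u₃ * u₄ * u₅ + u₂ * u₃ * u₄ * u₅) + (v₁ * v₂ + v₁ * v₃ + v₂ * v₃) * ((u₁ ^ 2 + u₂ ^ 2 + u₃ ^ 2 + u₄ ^ 2 + u₅ ^ 2) - (v₁ ^ 2 + v₂ ^ 2 + v₃ ^ 2)) / 2)) * (u₂ - v₁) := by ring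
  have hlu2 : (((u₁ * u₂ * u₃ * u₄ * u₅) + (v₁ * v₂ * v₃) * ((u₁ ^ 2 + u₂ ^ 2 + u₃ ^ 2 + u₄ ^ 2 + u₅ ^ 2) - (v₁ ^ 2 + v₂ ^ 2 + v₃ ^ 2)) / 2) + (-((u₁ * u₂ * u₃ * u₄ + u₁ * u₂ * u₃ * u₅ + u₁ * u₂ * u₄ * u₅ + u₁ * u₃ * u₄ * u₅ + u₂ * u₃ * u₄ * u₅) + (v₁ * v₂ + v₁ * v₃ + v₂ * v₃) * ((u₁ ^ 2 + u₂ ^ 2 + u₃ ^ 2 + u₄ ^ 2 + u₅ ^ 2) - (v₁ ^ 2 + v₂ ^ 2 + v₃ ^ 2)) / 2)) * u₂) < 0 := by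
    rw [eu2, ← hl1]
    have : (-((u₁ * u₂ * u₃ * u₄ + u₁ * u₂ * u₃ * u₅ + u₁ * u₂ * u₄ * u₅ + u₁ * u₃ * u₄ * u₅ + u₂ * u₃ * u₄ * u₅) + (v₁ * v₂ + v₁ * v₃ + v₂ * v₃) * ((u₁ ^ 2 + u₂ ^ 2 + u₃ ^ 2 + u₄ ^ 2 + u₅ ^ 2) - (v₁ ^ 2 + v₂ ^ 2 + v₃ ^ 2)) / 2)) * (u₂ - v₁) < 0 := mul_neg_of_neg_of_pos hσ (by linarith only [h₁, h₂, h₂₃, h₃, h₃₃, h₄, h₄₅])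
    linarith only [hK1, this]
  have eu5 : (((u₁ * u₂ * u₃ * u₄ * u₅) + (v₁ * v₂ * v₃) * ((u₁ ^ 2 + u₂ ^ 2 + u₃ ^ 2 + u₄ ^ 2 + u₅ ^ 2) - (v₁ ^ 2 + v₂ ^ 2 + v₃ ^ 2)) / 2) + (-((u₁ * u₂ * u₃ * u₄ + u₁ * u₂ * u₃ * u₅ + u₁ * u₂ * u₄ * u₅ + u₁ * u₃ * u₄ * u₅ + u₂ * u₃ * u₄ * u₅) + (v₁ * v₂ + v₁ * v₃ + v₂ * v₃) * ((u₁ ^ 2 + u₂ ^ 2 + u₃ ^ 2 + u₄ ^ 2 + u₅ ^ 2) - (v₁ ^ 2 + v₂ ^ 2 + v₃ ^ 2)) / 2)) * u₅) = (((u₁ * u₂ * u₃ * u₄ * u₅) + (v₁ * v₂ * v₃) * ((u₁ ^ 2 + u₂ ^ 2 + u₃ ^ 2 + u₄ ^ 2 + u₅ ^ 2) - (v₁ ^ 2 + v₂ ^ 2 + v₃ ^ 2)) / 2) + (-((u₁ * u₂ * u₃ * u₄ + u₁ * u₂ * u₃ * u₅ + u₁ * u₂ * u₄ * u₅ + u₁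 * u₃ * u₄ * u₅ + u₂ * u₃ * u₄ * u₅) + (v₁ * v₂ + v₁ * v₃ + v₂ * v₃) * ((u₁ ^ 2 + u₂ ^ 2 + u₃ ^ 2 + u₄ ^ 2 + u₅ ^ 2) - (v₁ ^ 2 + v₂ ^ 2 + v₃ ^ 2)) / 2)) * v₃) + (-((u₁ * u₂ * u₃ * u₄ + u₁ * u₂ * u₃ * u₅ + u₁ * u₂ * u₄ * u₅ + u₁ * u₃ * u₄ * u₅ + u₂ * u₃ * u₄ * u₅) + (v₁ * v₂ + v₁ * v₃ + v₂ * v₃) * ((u₁ ^ 2 + u₂ ^ 2 + u₃ ^ 2 + u₄ ^ 2 + u₅ ^ 2) - (v₁ ^ 2 + v₂ ^ 2 + v₃ ^ 2)) / 2)) * (u₅ - v₃) := by ring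
  have hlu5 : (((u₁ * u₂ * u₃ * u₄ * u₅) + (v₁ * v₂ * v₃) * ((u₁ ^ 2 + u₂ ^ 2 + u₃ ^ 2 + u₄ ^ 2 + u₅ ^ 2) - (v₁ ^ 2 + v₂ ^ 2 + v₃ ^ 2)) / 2) + (-((u₁ * u₂ * u₃ * u₄ + u₁ * u₂ * u₃ * u₅ + u₁ * u₂ * u₄ * u₅ + u₁ * u₃ * u₄ * u₅ + u₂ * u₃ * u₄ * u₅) + (v₁ * v₂ + v₁ * v₃ + v₂ * v₃) * ((u₁ ^ 2 + u₂ ^ 2 + u₃ ^ 2 + u₄ ^ 2 + u₅ ^ 2) - (v₁ ^ 2 + v₂ ^ 2 + v₃ ^ 2)) / 2)) * u₅) < 0 := by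
    rw [eu5, ← hl3]
    have : (-((u₁ * u₂ * u₃ * u₄ + u₁ * u₂ * u₃ * u₅ + u₁ * u₂ * u₄ * u₅ + u₁ * u₃ * u₄ * u₅ + u₂ * u₃ * u₄ * u₅) + (v₁ * v₂ + v₁ * v₃ + v₂ * v₃) * ((u₁ ^ 2 + u₂ ^ 2 + u₃ ^ 2 + u₄ ^ 2 + u₅ ^ 2) - (v₁ ^ 2 + v₂ ^ 2 + v₃ ^ 2)) / 2)) * (u₅ - v₃) < 0 := mul_neg_of_neg_of_pos hσ (by linarith only [h₁, h₂, h₂₃, h₃, h₃₃, h₄, h₄₅])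
    linarith only [hK3, this]
  have c21 : 0 < u₂ - v₁ := by linarith only [h₁, h₂, h₂₃, h₃, h₃₃, h₄, h₄₅]
  have c22 : u₂ - v₂ < 0 := by linarith only [h₁, h₂, h₂₃, h₃, h₃₃, h₄, h₄₅]
  have c23 : u₂ - v₃ < 0 := by linarith only [h₁, h₂, h₂₃, h₃, h₃₃, h₄, h₄₅]
  have hC2 : 0 < ((u₂ - v₁) * (u₂ - v₂) * (u₂ - v₃)) := (mul_pos_of_neg_of_neg (mul_neg_of_pos_of_neg c21 c22) c23)
  have hq2 := wall_eq_line₂ u₁ u₂ u₃ u₄ u₅ v₁ v₂ v₃ hC hP4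
  have hw2 : (u₂ ^ 2 - ((u₁ ^ 2 + u₂ ^ 2 + u₃ ^ 2 + u₄ ^ 2 + u₅ ^ 2) - (v₁ ^ 2 + v₂ ^ 2 + v₃ ^ 2)) / 2) < 0 := by
    have h : (u₂ ^ 2 - ((u₁ ^ 2 + u₂ ^ 2 + u₃ ^ 2 + u₄ ^ 2 + u₅ ^ 2) - (v₁ ^ 2 + v₂ ^ 2 + v₃ ^ 2)) / 2) * ((u₂ - v₁) * (u₂ - v₂) * (u₂ - v₃)) < 0 := by rw [hq2]; exact hlu2
    exact neg_of_mul_neg_of_pos _ _ h hC2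
  have c51 : 0 < u₅ - v₁ := by linarith only [h₁, h₂, h₂₃, h₃, h₃₃, h₄, h₄₅]
  have c52 : 0 < u₅ - v₂ := by linarith only [h₁, h₂, h₂₃, h₃, h₃₃, h₄, h₄₅]
  have c53 : 0 < u₅ - v₃ := by linarith only [h₁, h₂, h₂₃, h₃, h₃₃, h₄, h₄₅]
  have hC5 : 0 < ((u₅ - v₁) * (u₅ - v₂) * (u₅ - v₃)) := (mul_pos (mul_pos c51 c52) c53)
  have hq5 := wall_eq_line₅ u₁ u₂ u₃ u₄ u₅ v₁ v₂ v₃ hC hP4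
  have hw5 : (u₅ ^ 2 - ((u₁ ^ 2 + u₂ ^ 2 + u₃ ^ 2 + u₄ ^ 2 + u₅ ^ 2) - (v₁ ^ 2 + v₂ ^ 2 + v₃ ^ 2)) / 2) < 0 := by
    have h : (u₅ ^ 2 - ((u₁ ^ 2 + u₂ ^ 2 + u₃ ^ 2 + u₄ ^ 2 + u₅ ^ 2) - (v₁ ^ 2 + v₂ ^ 2 + v₃ ^ 2)) / 2) * ((u₅ - v₁) * (u₅ - v₂) * (u₅ - v₃)) < 0 := by rw [hq5]; exact hlu5
    exact neg_of_mul_neg_of_pos _ _ h hC5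
  have i2 := inside_of_wall_neg u₂ ρ ((u₁ ^ 2 + u₂ ^ 2 + u₃ ^ 2 + u₄ ^ 2 + u₅ ^ 2) - (v₁ ^ 2 + v₂ ^ 2 + v₃ ^ 2)) hρ hρ2 hw2
  have i5 := inside_of_wall_neg u₅ ρ ((u₁ ^ 2 + u₂ ^ 2 + u₃ ^ 2 + u₄ ^ 2 + u₅ ^ 2) - (v₁ ^ 2 + v₂ ^ 2 + v₃ ^ 2)) hρ hρ2 hw5
  exact ⟨i2.1, i5.2⟩

set_option maxHeartbeats 1600000 in
/-- TYPE REDUCTION for (0,3,3), charge part (`v₁ < u₁ ≤ u₂ ≤ u₃ < v₂ ≤ v₃ < u₄ ≤ u₅`, `Q₄ < 0`): `−ρ < u₄` and `u₅ < ρ`. -/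
theorem types_033_core (u₁ u₂ u₃ u₄ u₅ v₁ v₂ v₃ ρ : ℝ)
    (hC : u₁ + u₂ + u₃ + u₄ + u₅ = v₁ + v₂ + v₃)
    (hP4 : (u₁ ^ 3 + u₂ ^ 3 + u₃ ^ 3 + u₄ ^ 3 + u₅ ^ 3) - (v₁ ^ 3 + v₂ ^ 3 + v₃ ^ 3) = 0)
    (h₁ : v₁ < u₁) (h₁₂ : u₁ ≤ u₂) (h₂₃ : u₂ ≤ u₃) (h₃ : u₃ < v₂) (h₃₃ : v₂ ≤ v₃) (h₄ : v₃ < u₄) (h₄₅ : u₄ ≤ u₅)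
    (hQ4 : 3 * ((u₁ ^ 4 + u₂ ^ 4 + u₃ ^ 4 + u₄ ^ 4 + u₅ ^ 4) - (v₁ ^ 4 + v₂ ^ 4 + v₃ ^ 4)) - (3 / 2) * ((u₁ ^ 2 + u₂ ^ 2 + u₃ ^ 2 + u₄ ^ 2 + u₅ ^ 2) - (v₁ ^ 2 + v₂ ^ 2 + v₃ ^ 2)) ^ 2 < 0)
    (hρ : 0 ≤ ρ) (hρ2 : ρ ^ 2 = ((u₁ ^ 2 + u₂ ^ 2 + u₃ ^ 2 + u₄ ^ 2 + u₅ ^ 2) - (v₁ ^ 2 + v₂ ^ 2 + v₃ ^ 2)) / 2) :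
    -ρ < u₄ ∧ u₅ < ρ := by
  have hσ : (-((u₁ * u₂ * u₃ * u₄ + u₁ * u₂ * u₃ * u₅ + u₁ * u₂ * u₄ * u₅ + u₁ * u₃ * u₄ * u₅ + u₂ * u₃ * u₄ * u₅) + (v₁ * v₂ + v₁ * v₃ + v₂ * v₃) * ((u₁ ^ 2 + u₂ ^ 2 + u₃ ^ 2 + u₄ ^ 2 + u₅ ^ 2) - (v₁ ^ 2 + v₂ ^ 2 + v₃ ^ 2)) / 2)) < 0 := by
    have e := Q4_eq_slope u₁ u₂ u₃ u₄ u₅ v₁ v₂ v₃ hC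
    rw [hP4] at e
    linarith only [e, hQ4]
  have k31 : u₁ - v₃ < 0 := by linarith only [h₁, h₁₂, h₂₃, h₃, h₃₃, h₄, h₄₅]
  have k32 : u₂ - v₃ < 0 := by linarith only [h₁, h₁₂, h₂₃, h₃, h₃₃, h₄, h₄₅]
  have k33 : u₃ - v₃ < 0 := by linarith only [h₁, h₁₂, h₂₃, h₃, h₃₃, h₄, h₄₅]
  have k34 : 0 < u₄ - v₃ := by linarith only [h₁, h₁₂, h₂₃, h₃, h₃₃, h₄, h₄₅]
  have k35 : 0 < u₅ - v₃ := by linarith only [h₁, h₁₂, h₂₃, h₃, h₃₃, h₄, h₄₅]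
  have hK3 : (u₁ - v₃) * (u₂ - v₃) * (u₃ - v₃) * (u₄ - v₃) * (u₅ - v₃) < 0 := (mul_neg_of_neg_of_pos (mul_neg_of_neg_of_pos (mul_neg_of_pos_of_neg (mul_pos_of_neg_of_neg k31 k32) k33) k34) k35)

  have hl3 := K0_eq_line₃ u₁ u₂ u₃ u₄ u₅ v₁ v₂ v₃ hC hP4
  have eu4 : (((u₁ * u₂ * u₃ * u₄ * u₅) + (v₁ * v₂ * v₃) * ((u₁ ^ 2 + u₂ ^ 2 + u₃ ^ 2 + u₄ ^ 2 + u₅ ^ 2) - (v₁ ^ 2 + v₂ ^ 2 + v₃ ^ 2)) / 2) + (-((u₁ * u₂ * u₃ * u₄ + u₁ * u₂ * u₃ * u₅ + u₁ * u₂ * u₄ * u₅ + u₁ * u₃ * u₄ * u₅ + u₂ * u₃ * u₄ * u₅) + (v₁ * v₂ + v₁ * v₃ + v₂ * v₃) * ((u₁ ^ 2 + u₂ ^ 2 + u₃ ^ 2 + u₄ ^ 2 + u₅ ^ 2) - (v₁ ^ 2 + v₂ ^ 2 + v₃ ^ 2)) / 2)) * u₄) = (((u₁ * u₂ * u₃ *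 u₄ * u₅) + (v₁ * v₂ * v₃) * ((u₁ ^ 2 + u₂ ^ 2 + u₃ ^ 2 + u₄ ^ 2 + u₅ ^ 2) - (v₁ ^ 2 + v₂ ^ 2 + v₃ ^ 2)) / 2) + (-((u₁ * u₂ * u₃ * u₄ + u₁ * u₂ * u₃ * u₅ + u₁ * u₂ * u₄ * u₅ + u₁ * u₃ * u₄ * u₅ + u₂ * u₃ * u₄ * u₅) + (v₁ * v₂ + v₁ * v₃ + v₂ * v₃) * ((u₁ ^ 2 + u₂ ^ 2 + u₃ ^ 2 + u₄ ^ 2 + u₅ ^ 2) - (v₁ ^ 2 + v₂ ^ 2 + v₃ ^ 2)) / 2)) * v₃) + (-((u₁ * u₂ * u₃ * u₄ + u₁ * u₂ * u₃ * u₅ + u₁ * u₂ * u₄ * u₅ + u₁ * u₃ * u₄ * u₅ + u₂ * u₃ * u₄ * u₅) + (v₁ * v₂ + v₁ * v₃ + v₂ * v₃) * ((u₁ ^ 2 + u₂ ^ 2 + u₃ ^ 2 + u₄ ^ 2 + u₅ ^ 2) - (v₁ ^ 2 + v₂ ^ 2 + v₃ ^ 2)) / 2)) * (u₄ - v₃)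 := by ring
  have hlu4 : (((u₁ * u₂ * u₃ * u₄ * u₅) + (v₁ * v₂ * v₃) * ((u₁ ^ 2 + u₂ ^ 2 + u₃ ^ 2 + u₄ ^ 2 + u₅ ^ 2) - (v₁ ^ 2 + v₂ ^ 2 + v₃ ^ 2)) / 2) + (-((u₁ * u₂ * u₃ * u₄ + u₁ * u₂ * u₃ * u₅ + u₁ * u₂ * u₄ * u₅ + u₁ * u₃ * u₄ * u₅ + u₂ * u₃ * u₄ * u₅) + (v₁ * v₂ + v₁ * v₃ + v₂ * v₃) * ((u₁ ^ 2 + u₂ ^ 2 + u₃ ^ 2 + u₄ ^ 2 + u₅ ^ 2) - (v₁ ^ 2 + v₂ ^ 2 + v₃ ^ 2)) / 2)) * u₄) < 0 := by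
    rw [eu4, ← hl3]
    have : (-((u₁ * u₂ * u₃ * u₄ + u₁ * u₂ * u₃ * u₅ + u₁ * u₂ * u₄ * u₅ + u₁ * u₃ * u₄ * u₅ + u₂ * u₃ * u₄ * u₅) + (v₁ * v₂ + v₁ * v₃ + v₂ * v₃) * ((u₁ ^ 2 + u₂ ^ 2 + u₃ ^ 2 + u₄ ^ 2 + u₅ ^ 2) - (v₁ ^ 2 + v₂ ^ 2 + v₃ ^ 2)) / 2)) * (u₄ - v₃) < 0 := mul_neg_of_neg_of_pos hσ (by linarith only [h₁, h₁₂, h₂₃, h₃, h₃₃, h₄, h₄₅])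
    linarith only [hK3, this]
  have eu5 : (((u₁ * u₂ * u₃ * u₄ * u₅) + (v₁ * v₂ * v₃) * ((u₁ ^ 2 + u₂ ^ 2 + u₃ ^ 2 + u₄ ^ 2 + u₅ ^ 2) - (v₁ ^ 2 + v₂ ^ 2 + v₃ ^ 2)) / 2) + (-((u₁ * u₂ * u₃ * u₄ + u₁ * u₂ * u₃ * u₅ + u₁ * u₂ * u₄ * u₅ + u₁ * u₃ * u₄ * u₅ + u₂ * u₃ * u₄ * u₅) + (v₁ * v₂ + v₁ * v₃ + v₂ * v₃) * ((u₁ ^ 2 + u₂ ^ 2 + u₃ ^ 2 + u₄ ^ 2 + u₅ ^ 2) - (v₁ ^ 2 + v₂ ^ 2 + v₃ ^ 2)) / 2)) * u₅) = (((u₁ * u₂ * u₃ * u₄ * u₅) + (v₁ * v₂ * v₃) * ((u₁ ^ 2 + u₂ ^ 2 + u₃ ^ 2 + u₄ ^ 2 + u₅ ^ 2) - (v₁ ^ 2 + v₂ ^ 2 + v₃ ^ 2)) / 2) + (-((u₁ * u₂ * u₃ * u₄ + u₁ * u₂ * u₃ * u₅ + u₁ * u₂ * u₄ * u₅ + u₁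 * u₃ * u₄ * u₅ + u₂ * u₃ * u₄ * u₅) + (v₁ * v₂ + v₁ * v₃ + v₂ * v₃) * ((u₁ ^ 2 + u₂ ^ 2 + u₃ ^ 2 + u₄ ^ 2 + u₅ ^ 2) - (v₁ ^ 2 + v₂ ^ 2 + v₃ ^ 2)) / 2)) * v₃) + (-((u₁ * u₂ * u₃ * u₄ + u₁ * u₂ * u₃ * u₅ + u₁ * u₂ * u₄ * u₅ + u₁ * u₃ * u₄ * u₅ + u₂ * u₃ * u₄ * u₅) + (v₁ * v₂ + v₁ * v₃ + v₂ * v₃) * ((u₁ ^ 2 + u₂ ^ 2 + u₃ ^ 2 + u₄ ^ 2 + u₅ ^ 2) - (v₁ ^ 2 + v₂ ^ 2 + v₃ ^ 2)) / 2)) * (u₅ - v₃) := by ring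
  have hlu5 : (((u₁ * u₂ * u₃ * u₄ * u₅) + (v₁ * v₂ * v₃) * ((u₁ ^ 2 + u₂ ^ 2 + u₃ ^ 2 + u₄ ^ 2 + u₅ ^ 2) - (v₁ ^ 2 + v₂ ^ 2 + v₃ ^ 2)) / 2) + (-((u₁ * u₂ * u₃ * u₄ + u₁ * u₂ * u₃ * u₅ + u₁ * u₂ * u₄ * u₅ + u₁ * u₃ * u₄ * u₅ + u₂ * u₃ * u₄ * u₅) + (v₁ * v₂ + v₁ * v₃ + v₂ * v₃) * ((u₁ ^ 2 + u₂ ^ 2 + u₃ ^ 2 + u₄ ^ 2 + u₅ ^ 2) - (v₁ ^ 2 + v₂ ^ 2 + v₃ ^ 2)) / 2)) * u₅) < 0 := by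
    rw [eu5, ← hl3]
    have : (-((u₁ * u₂ * u₃ * u₄ + u₁ * u₂ * u₃ * u₅ + u₁ * u₂ * u₄ * u₅ + u₁ * u₃ * u₄ * u₅ + u₂ * u₃ * u₄ * u₅) + (v₁ * v₂ + v₁ * v₃ + v₂ * v₃) * ((u₁ ^ 2 + u₂ ^ 2 + u₃ ^ 2 + u₄ ^ 2 + u₅ ^ 2) - (v₁ ^ 2 + v₂ ^ 2 + v₃ ^ 2)) / 2)) * (u₅ - v₃) < 0 := mul_neg_of_neg_of_pos hσ (by linarith only [h₁, h₁₂, h₂₃, h₃, h₃₃, h₄, h₄₅])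
    linarith only [hK3, this]
  have c41 : 0 < u₄ - v₁ := by linarith only [h₁, h₁₂, h₂₃, h₃, h₃₃, h₄, h₄₅]
  have c42 : 0 < u₄ - v₂ := by linarith only [h₁, h₁₂, h₂₃, h₃, h₃₃, h₄, h₄₅]
  have c43 : 0 < u₄ - v₃ := by linarith only [h₁, h₁₂, h₂₃, h₃, h₃₃, h₄, h₄₅]
  have hC4 : 0 < ((u₄ - v₁) * (u₄ - v₂) * (u₄ - v₃)) := (mul_pos (mul_pos c41 c42) c43)
  have hq4 := wall_eq_line₄ u₁ u₂ u₃ u₄ u₅ v₁ v₂ v₃ hC hP4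
  have hw4 : (u₄ ^ 2 - ((u₁ ^ 2 + u₂ ^ 2 + u₃ ^ 2 + u₄ ^ 2 + u₅ ^ 2) - (v₁ ^ 2 + v₂ ^ 2 + v₃ ^ 2)) / 2) < 0 := by
    have h : (u₄ ^ 2 - ((u₁ ^ 2 + u₂ ^ 2 + u₃ ^ 2 + u₄ ^ 2 + u₅ ^ 2) - (v₁ ^ 2 + v₂ ^ 2 + v₃ ^ 2)) / 2) * ((u₄ - v₁) * (u₄ - v₂) * (u₄ - v₃)) < 0 := by rw [hq4]; exact hlu4
    exact neg_of_mul_neg_of_pos _ _ h hC4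
  have c51 : 0 < u₅ - v₁ := by linarith only [h₁, h₁₂, h₂₃, h₃, h₃₃, h₄, h₄₅]
  have c52 : 0 < u₅ - v₂ := by linarith only [h₁, h₁₂, h₂₃, h₃, h₃₃, h₄, h₄₅]
  have c53 : 0 < u₅ - v₃ := by linarith only [h₁, h₁₂, h₂₃, h₃, h₃₃, h₄, h₄₅]
  have hC5 : 0 < ((u₅ - v₁) * (u₅ - v₂) * (u₅ - v₃)) := (mul_pos (mul_pos c51 c52) c53)
  have hq5 := wall_eq_line₅ u₁ u₂ u₃ u₄ u₅ v₁ v₂ v₃ hC hP4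
  have hw5 : (u₅ ^ 2 - ((u₁ ^ 2 + u₂ ^ 2 + u₃ ^ 2 + u₄ ^ 2 + u₅ ^ 2) - (v₁ ^ 2 + v₂ ^ 2 + v₃ ^ 2)) / 2) < 0 := by
    have h : (u₅ ^ 2 - ((u₁ ^ 2 + u₂ ^ 2 + u₃ ^ 2 + u₄ ^ 2 + u₅ ^ 2) - (v₁ ^ 2 + v₂ ^ 2 + v₃ ^ 2)) / 2) * ((u₅ - v₁) * (u₅ - v₂) * (u₅ - v₃)) < 0 := by rw [hq5]; exact hlu5
    exact neg_of_mul_neg_of_pos _ _ h hC5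
  have i4 := inside_of_wall_neg u₄ ρ ((u₁ ^ 2 + u₂ ^ 2 + u₃ ^ 2 + u₄ ^ 2 + u₅ ^ 2) - (v₁ ^ 2 + v₂ ^ 2 + v₃ ^ 2)) hρ hρ2 hw4
  have i5 := inside_of_wall_neg u₅ ρ ((u₁ ^ 2 + u₂ ^ 2 + u₃ ^ 2 + u₄ ^ 2 + u₅ ^ 2) - (v₁ ^ 2 + v₂ ^ 2 + v₃ ^ 2)) hρ hρ2 hw5
  exact ⟨i4.1, i5.2⟩

end Summit.HodgeConjecture.HodgeConjecture.WeilClassTestFormatFiveThreeTypes
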